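import Literature.MathematicalPhysics.QuantumFieldTheory.Balaban1983to89.B3Ineq31RegularTorus
import Literature.MathematicalPhysics.QuantumFieldTheory.Balaban1983to89.B3Ineq211RegularRegion
import Literature.MathematicalPhysics.QuantumFieldTheory.Balaban1983to89.B3Ineq210MixedRegularRegion
import Literature.MathematicalPhysics.QuantumFieldTheory.Balaban1983to89.B3Ineq212VectorTorus

/-!
# Bałaban, *(Higgs)₂,₃ quantum fields in a finite volume III. Renormalization* [B3] — (3.1) p. 432,
`‖hG_k(Ω,B̃)h′‖_{1,α} ≤ O(1)e^{−δ₀dist(□(v),□(v′))}`, AT A REGULAR NON-CONSTANT BACKGROUND `B̃ = A` ON A BIG-BLOCK-UNION REGION `Ω ⊆ T_η`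
(every block size `L ≥ 2`), for the interior unit cubes, PROVED for a concrete carrier of `B3Sect3Statements.Sect3Data` (the decl of
record `Sect3Data.Ineq31 α δ₀ C` of row B3.Eq3.1, per `0 ≤ α < 1`) — and the printed clause «and similarly for the vector field propagator»
PROVED as its instance `Ω = T_ε`, `A = 0`, `N = d` (every `L ≥ 2`, all unit cubes)

statement-level skeleton of published theorems with citation tags; proofs where landed; nothing here is a claim about the Yang–Mills mass gap

T. Bałaban, Commun. Math. Phys. **88** (1983) 411–445 [cite: Balaban1983Higgs3]; inputs from part I, Commun. Math. Phys. **85** (1982)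
603–636 [cite: Balaban1982Higgs1] as landed in the tree.  PDF held: `paper:balaban1983-higgs-2-3-quantum-fields-finite-volume` (journal page =
PDF page + 410), p. 414 [PDF 4], p. 420 [PDF 10] (`p0010.txt`), p. 424 [PDF 14], p. 426 [PDF 16], p. 432–433 [PDF 22–23] (`p0022.txt`).

CITATION HEADER (lean-in-tree rule).  Cell `lit-balaban` (HOME `run/shared/lean/pub/lit-balaban/`), Phase-2 proof seat **p40** gen 69 (unit
`lit-balaban-p40`); SKELETON row **B3.Eq3.1** (fold owner r15; decl of record `B3Sect3Statements.Sect3Data.Ineq31`; `B3-CLOSURE.md` §5 item 5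
«(3.1) on regions»).  REGION TWIN of this seat's `B3Ineq31RegularTorus` (gen 68, p342325: the same row on the whole torus `Ω = T_η` in the
odd-`L` `Shape` family), in the way r14 g17's `B3Ineq210RegularRegion` is the region twin of `B3Ineq210RegularTorus`.  USED BY NAME, never
restated: the torus twin's Ω-free §§1, 2, 6, 7 (cube geometry `cubeDist`/`sep_of_cubes`/`cubeDist_le_sepD`/`tdist_le_of_same_cube`, the
coordinatewise contours `cpath` staying inside a cube `blockIter_eq_of_mem_cpath`, the scale sum `sum_pieces_sep_le'`/`phiSum`, the
product-lattice data `PSite`/`PBd`/`hb`/`dirOf`/`baseOf`/`pdist`/`sites`/`bonds`/`unitV`/`unitD`/`transp`, the weights `weightV_le`/`weightD_le`/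
`weightM_le`/`weightH_le`); r14 g17's region pieces (2.6) `B3Ineq210RegularRegion.pieceR`/`sum_pieceR`, interior points `Interior`, big-block
unions `IsBigBlockUnion`, and (2.10) on regions with one smallness parameter `ineq210_regularRegion_explicit_small` (p340643 / v1.2 p342745);
p35 g16's (2.11) on regions `B3Ineq211RegularRegion.ineq211At_regularRegion_small_explicit` with `holderTermR` (p341249 / v1.1); p33 g58's
mixed (twice-differentiated) clause of (2.10) on regions `B3Ineq210MixedRegularRegion.ineq210_mixed_regularRegion` with `mixedTermR` and the
adjoint identity of the region kernel `inner_covDeriv_propagatorK_single_R` (p343340); the dipole source `dip`, `onb`, `norm_covDeriv_dip_le_sum`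
of `B3Ineq210MixedRegularTorus` (p341241); p26's admissible contours `IsAdm`; p35's chain transport `B1TorusChainTransport.hol`/
`norm_hol_apply_sub_le` (the path lemma); p33 g57's vector-field pieces `B3Ineq212VectorTorus.vecPieceOp` (p341717); the typer's `zeroCharge`;
the printed SUM form of (1.32) `B3Sect1Statements.norm132`.

## What is printed (verbatim)

p. 432 [PDF 22]: *"Now if two vertices, v, v′ have localizations satisfying dist(□(v), □(v′)) ≥ 1, then we consider every propagator
corresponding to a line connecting these vertices as an external field also. Such a possibility is assured by the following estimates
‖hG_k(Ω, B̃)h′‖_{1,α} ≤ O(1)e^{−δ₀dist(□(v),□(v′))}, (3.1) and similarly for the vector field propagator, h, h′ are localization functions."*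
p. 420 [PDF 10]: *"For a scalar field f of one variable we define ‖f‖_{1,α} = sup_x|f(x)| + sup_{x,μ}|(D^η_{B̃,μ}f)(x)| +
sup_{x,x′,μ} |x − x′|^{−α}|U(B̃(Γ_{x,x′}))(D^η_{B̃,μ}f)(x′) − (D^η_{B̃,μ}f)(x)|, (1.32) where Γ_{x,x′} is a shortest contour connecting x and x′.
This definition extends in a natural way to functions of many variables. For external vector fields we have the same definition, but with
B̃ = 0."*  p. 414 [PDF 4]: *"the field A′ has the covariance G_k. The basic propagator for the scalar field φ′ is G_k(Ω, B̃)"*.  The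
localizations `h, h′` are (the characteristic functions of) unit cubes `□(v)` of the `η`-lattice (p. 420: *"we localize simply by
representing Ω₁ as a sum of unit cubes"*).

## What this file proves, and how

THE OBJECT.  `G_k(Ω, A) = G^ε_k(Ω, A)` is the REGION propagator of [B1] (2.20)/(2.24) (`HiggsCovariance.propagatorK C Ω A m² a k`) on a region
`Ω ⊆ T_ε` that is a union of big blocks (`IsBigBlockUnion k K₀ Ω`, cubes of `K₀` `k`-blocks a side), at a background `A` that is `δ_A`-regular
ON `Ω` in the sense (I.2.23) (`|A⟨z+e_ν,μ⟩ − A⟨z,μ⟩| ≤ δ_A`, `z ∈ Ω`, `L^k·δ_A·|e| ≤ t`), decomposed into the pieces (2.6) `G^η_{(j)}(Ω, A)`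
(`pieceR`, `sum_pieceR`).  The two-variable field `F(x,x′) = G_k(Ω,A;x,x′) ∈ Hom(ℝ^N_{x′}, ℝ^N_x)` on `□(v) × □(v′)` and its norm (1.32) are read
EXACTLY as in the torus twin (§§3–4 below; values = `N × N` blocks with the operator norm in the print's units `unitV = (L^kε)^{d−2}ε^{−d}`,
covariant derivatives along the `2d` directions of the product lattice with unit `unitD = (L^kε)^{d−1}ε^{−d}`, Hölder quotients over all
same-direction bond pairs at positive sup-distance `|z − z′|/L^k`, transports `U(A(Γ))∘·∘U(A(Γ′))^*` along the coordinatewise shortest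
contours `cpath` in both variables, assembled by the printed SUM `norm132`).  THE CUBES: the localization functions are the SHARP UNIT
CUBES `□(v) = {x ∈ T_η : ⌊x/L^k⌋ = v}`, `v ∈ T_1^{(k)}` (p. 420 *"we localize simply by representing Ω₁ as a sum of unit cubes"*); the located
region inputs hold at INTERIOR points — r14's `Interior k K₀ Ω x`: the lattice ball of radius `2r_S + 2L^kK₀(d+1) + 1` about `x` lies in `Ω`,
the margin realising the `R₀`-restriction «dist({x,x′}, Ωᶜ) ≥ R₀» of Proposition I.2.1 in the tree's constants — so the carrier's `LocFn` is
the type `IntCube k K₀ Ω` of INTERIOR unit cubes (every point of `□(v)` interior); for `Ω = T_ε` every cube is interior (`intCube_univ`).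

THE THEOREMS.  (a) **`ineq31R_of_bounds`** (§5, an IMPLICATION, the analogue of r14's `ineq210_of_boundsR`): the four kernel inputs in the
model's units at interior points — value and row-derivative clauses of (2.10), the Hölder clause (2.11) on admissible contours, and the mixed
(twice-differentiated) clause of (2.10) `mixedTermR` — with rates `δ₁, δ₂, δ₃` give `(sect3RegRegion …).Ineq31 α (δL/2) ((2C_V + C_H + dC_M)Φ)`,
`δ = min δᵢ`.  (b) **`ineq31_regularRegion`** (§6, HYPOTHESIS-FREE): (3.1) for the region carrier under exactly the hypotheses of r14's
`ineq210_regularRegion_small` (`K₀ ∣ M`, `K₀ ≥ K₀min`, `3L^kK₀ ≤ |T_ε|_μ`, `1 ≤ k ≤ K`, `L^kε ≤ 1`, `IsBigBlockUnion k K₀ Ω`, `A` `δ_A`-regular on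
`Ω` with `L^k·δ_A·|e| ≤ t`), the three located inputs DISCHARGED by r14's, p35's and p33's region theorems; `_explicit` (un-subtyped) and `_univ`
(`Ω = T_ε`, every `L ≥ 2`, all cubes) forms; on `Ω = T_ε` the quantity IS the torus twin's (`normHGHR_univ`, `rfl`; at the carrier level
`ineq31R_univ_iff_torus`), so the torus twin's `normHGH` obeys (3.1) for EVERY `L ≥ 2` (`ineq31_regularTorus_allL`: the odd-`L` restriction of
its `Shape` inputs lifted).
(c) **`ineq31_vectorTorus`** (§7): the printed clause *"and similarly for the vector field
propagator"* — the instance `C = zeroCharge d` (`N = d`), `Ω = T_ε`, `A = 0` of (b): the two-variable field is the kernel of the vector-field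
propagator `G_k` of p. 414 whose pieces are p33's `vecPieceOp` (`kerFR_vector_apply`), and the norm (1.32) is taken *"with B̃ = 0"* — all
transports are identities (`transp_zeroCharge`).  THE ROUTE is the torus twin's, word for word, with `G_k(T_η, A)` replaced by `G_k(Ω, A)`:
§1 `G_k(Ω,A)` below its pieces; §2 the blocks, the row move and THE COLUMN MOVE (the adjoint identity of the region kernel — the column slice of
the row-differentiated kernel is `ε^{−1}G_k(Ω,A)dip_b w`, p33 — and p35's path lemma on that column field inside the cube `□(v′)`, whose steps
are bounded by the mixed clause); §3 the field, the interior cubes and the carrier; §4 the three parts of (1.32); §5 the assembly; §6 the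
inputs read back and the theorem; §7 the full torus and the vector-field propagator.

## Honest scope

Interior unit cubes only (both cubes at lattice distance `≥ 2r_S + 2L^kK₀(d+1) + 1` from `T_ε ∖ Ω` — the `R₀`-restriction of the cited region
inputs; for `Ω = T_ε` no restriction); `Ω` a big-block union with `K₀ ∣ M`, `K₀ ≥ K₀min` and at least three big blocks a side
(`3L^kK₀ ≤ |T_ε|_μ`); `m² > 0`; every `L ≥ 2` (no parity); the constants depend on `α` AND on `K₀` as in the cited inputs (GAPS G-B3-11: the
print's `O(1), δ₀` are uniform); localization functions = sharp unit cubes, not a smooth partition; `|·|` of a block = operator norm on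
`ℝ^N → ℝ^N`; contours = the fixed coordinatewise shortest paths `cpath`; the (3.2)–(3.5) data of the carrier are NOT modelled (`RenClass′ = ∅`,
nothing claimed); `δG_k(Ω,Ω₂,B̃)`/(1.16) are (2.5), not this file; the vector-field propagator carries `μ₀² = m² > 0` ([B1] p. 605) and the
same volume sub-family (`K₀ ∣ M`, three cubes a side).  Non-vacuity of the hypotheses: r14's
`B3Ineq210RegularRegion.regularRegion_small_hypotheses_nonvacuous` (same hypotheses; a proper region with an interior point, `A = 0`).  No
`def … : Prop`, no new named fact (all `def`s here are concrete data: blocks, the field, the interior cubes, the carrier); axioms standard.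
Value = kernel certificate of one located estimate of B3 §3 at a regular background on regions and of its vector-field clause, NOT summit
progress.
-/

noncomputable section

open scoped BigOperators InnerProductSpace Matrix

namespace Literature.MathematicalPhysics.QuantumFieldTheory.Balaban1983to89.B3Ineq31RegularRegion

open HiggsLattice (ChargeData ScalarField siteInner covDeriv)
open HiggsCovariance (propagatorK E)
open HiggsAveraging (blockIter)
open B1Eq230FluctCov (Ix cb)
open B1Eq221Coordinates (fieldCoord)
open B1Ineq234Concrete (tdist_self)
open B1Ineq234LevelZero (tdist_comm)
open B1TorusChainTransport (IsTChain hol norm_hol_apply norm_hol_apply_sub_le hol_nil)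
open B1TorusCubeCover (half)
open B1TorusRegionHSizes (IsBigBlockUnion isBigBlockUnion_univ)
open B4GaugeCovariance (pathEnd)
open B3Sect3Statements (Sect3Data)
open B3Sect1Statements (norm132)
open LatticeNorms (supNorm_le holderSeminorm_le)
open B3Ineq210RegularTorus (mesh_eq_pow_mul)
open B3Ineq210RegularRegion (pieceR sum_pieceR Interior interior_univ ineq210_regularRegion_explicit_small)
open B3Ineq211RegularTorus (IsAdm)
open B3Ineq211RegularRegion (holderTermR ineq211At_regularRegion_small_explicit)
open B3Ineq210MixedRegularTorus (onb dip norm_covDeriv_dip_le_sum norm_apply_single_le norm_covDeriv_apply_single_le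
  abs_fieldCoord_single_le fieldCoord_single_of_ne)
open B3Ineq210MixedRegularRegion (mixedTermR inner_covDeriv_propagatorK_single_R ineq210_mixed_regularRegion)
open B3MultiscaleFields (zeroCharge zeroCharge_U)
open B3Ineq212VectorTorus (vecPieceOp)
open B3Ineq31RegularTorus (cubeDist cubeDist_nonneg cubeDist_comm cubeDist_le_sepD tdist_le_of_same_cube two_lt_sitesPerDir cpath
  isAdm_cpath pathEnd_cpath cpath_self blockIter_eq_of_mem_cpath PSite PBd hb dirOf baseOf pdist unitV unitD transp sites bonds mem_sites
  cubeB cubeY cubeDist_cubeB_cubeY bonds_spec phiSum sum_pieces_sep_le' weightV_le weightD_le weightM_le weightH_le norm_hol_comp_le)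

variable {P : HiggsLattice.Params} {N : ℕ}

/-! ## §0 Arithmetic of the units (as in the torus twin) -/

section Units

variable {k : ℕ}

/-- `unitV > 0`. [folklore] -/
private theorem unitV_pos (P : HiggsLattice.Params) (k : ℕ) : 0 < unitV P k := by
  unfold unitV; have := P.mesh_pos k; have := P.mesh_pos 0; positivity

/-- `unitD > 0`. [folklore] -/
private theorem unitD_pos (P : HiggsLattice.Params) (k : ℕ) : 0 < unitD P k := by
  unfold unitD; have := P.mesh_pos k; have := P.mesh_pos 0; positivity

/-- `Φ_p(δ, L) > 0` for `δ > 0`. [folklore] -/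
private theorem phiSum_pos {L : ℕ} (p : ℕ) {δ : ℝ} (hδ : 0 < δ) : 0 < phiSum L p δ := by
  unfold phiSum
  have h1 : 0 < (p.factorial : ℝ) / (δ * 1 / 2) ^ p := by positivity
  have h2 : 0 < 1 - Real.exp (-(δ * 1 / 2 * (((L - 1 : ℕ) : ℝ) + 1))) := by
    rw [sub_pos, Real.exp_lt_one_iff]
    have : (0 : ℝ) < ((L - 1 : ℕ) : ℝ) + 1 := by positivity
    nlinarith
  exact mul_pos h1 (inv_pos.mpr h2)

/-- `|x−x′|/L^j = (|x−x′|/L^k)·L^{k−j}` for `j ≤ k`. [folklore] -/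
private theorem div_pow_eq_div_mul_sc {j : ℕ} (hjk : j ≤ k) (t : ℝ) :
    t / (P.L : ℝ) ^ j = t / (P.L : ℝ) ^ k * (P.L : ℝ) ^ (k - j) := by
  have hL : (P.L : ℝ) ≠ 0 := by have := P.hL; positivity
  obtain ⟨m, rfl⟩ := Nat.exists_eq_add_of_le hjk
  rw [Nat.add_sub_cancel_left, pow_add]
  field_simp

/-- kernel: `(L^jη)^{2−d} = (L^jη)²·((L^jη)^d)^{−1}` (real exponent). [folklore] -/
private theorem rpow_two_sub (j : ℕ) : P.mesh j ^ ((2 : ℝ) - (P.d : ℝ)) = P.mesh j ^ 2 * (P.mesh j ^ P.d)⁻¹ := by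
  rw [Real.rpow_sub (P.mesh_pos j), div_eq_mul_inv, Real.rpow_natCast _ P.d, Real.rpow_two]

/-- kernel: `(L^jη)^{1−d} = (L^jη)·((L^jη)^d)^{−1}`. [folklore] -/
private theorem rpow_one_sub (j : ℕ) : P.mesh j ^ ((1 : ℝ) - (P.d : ℝ)) = P.mesh j * (P.mesh j ^ P.d)⁻¹ := by
  rw [Real.rpow_sub (P.mesh_pos j), div_eq_mul_inv, Real.rpow_natCast _ P.d, Real.rpow_one]

/-- kernel: `(L^jη)^{1−d−α} = (L^jη)·((L^jη)^d)^{−1}·((L^jη)^α)^{−1}`. [folklore] -/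
private theorem rpow_one_sub_sub (j : ℕ) (α : ℝ) :
    P.mesh j ^ ((1 : ℝ) - (P.d : ℝ) - α) = P.mesh j * (P.mesh j ^ P.d)⁻¹ * (P.mesh j ^ α)⁻¹ := by
  have hs := P.mesh_pos j
  rw [Real.rpow_sub hs, Real.rpow_sub hs, Real.rpow_one, Real.rpow_natCast _ P.d, div_eq_mul_inv, div_eq_mul_inv]

/-- kernel: `(L^jη)^{−1}·(ε·m) = m/L^j`. [folklore] -/
private theorem scale_inv_mul (j : ℕ) (m : ℝ) : (P.mesh j)⁻¹ * (P.mesh 0 * m) = m / (P.L : ℝ) ^ j := by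
  rw [mesh_eq_pow_mul P j, mul_inv, mul_assoc, ← mul_assoc (P.mesh 0)⁻¹, inv_mul_cancel₀ (P.mesh_pos 0).ne', one_mul,
    div_eq_inv_mul]

/-- weakening a decay rate. [folklore] -/
private theorem exp_rate_mono {δ δ' t : ℝ} (h : δ ≤ δ') (ht : 0 ≤ t) : Real.exp (-(δ' * t)) ≤ Real.exp (-(δ * t)) := by
  rw [Real.exp_le_exp]; nlinarith

/-- An operator norm from its bilinear form: `|⟨w, Xv⟩| ≤ B‖v‖‖w‖` for all `v, w` gives `‖X‖ ≤ B`. [folklore] -/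
private theorem opNorm_le_of_inner_le (X : E N →L[ℝ] E N) {B : ℝ} (hB : 0 ≤ B) (h : ∀ v w : E N, |⟪w, X v⟫_ℝ| ≤ B * ‖v‖ * ‖w‖) :
    ‖X‖ ≤ B := by
  refine ContinuousLinearMap.opNorm_le_bound _ hB fun v => ?_
  have h1 := h v (X v)
  rw [real_inner_self_eq_norm_sq, abs_of_nonneg (sq_nonneg _)] at h1
  by_cases h0 : ‖X v‖ = 0
  · rw [h0]; positivity
  · have hpos : 0 < ‖X v‖ := lt_of_le_of_ne (norm_nonneg _) (Ne.symm h0)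
    nlinarith

end Units

/-! ## §1 The region propagator `G_k(Ω, A) = Σ_{j<k} G^η_{(j)}(Ω, A)` below its pieces (2.6) -/

section Pieces

variable (C : ChargeData N) (Ω : Finset (HiggsLattice.Site P 0)) (A : HiggsLattice.VecField P 0) (msq a : ℝ) {k : ℕ}

/-- value: `‖(G^ε_k(Ω,A)φ)(x)‖ ≤ Σ_{j<k}‖(G^η_{(j)}(Ω,A)φ)(x)‖` ((2.6) on a region). [cite: Balaban1983Higgs3, (2.6) p.424] -/
theorem norm_G_apply_le_sumR (hm : 0 < msq) (ha : 0 < a) (hL1 : 1 < P.L) (hk : 1 ≤ k) (hkK : k ≤ P.K) (φ : ScalarField P 0 N)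
    (x : HiggsLattice.Site P 0) :
    ‖propagatorK C Ω A msq a k φ x‖ ≤ ∑ j ∈ Finset.range k, ‖pieceR C Ω A msq a k j φ x‖ := by
  rw [← sum_pieceR (C := C) (Ω := Ω) (A := A) hm ha hL1 hk hkK, LinearMap.sum_apply, Finset.sum_apply]
  exact norm_sum_le _ _

/-- row derivative: `‖(D^ε_AG^ε_k(Ω,A)φ)(b)‖ ≤ Σ_{j<k}‖(D^ε_AG^η_{(j)}(Ω,A)φ)(b)‖`. [cite: Balaban1983Higgs3, (2.6) p.424] -/
theorem norm_covDeriv_G_apply_le_sumR (hm : 0 < msq) (ha : 0 < a) (hL1 : 1 < P.L) (hk : 1 ≤ k) (hkK : k ≤ P.K)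
    (φ : ScalarField P 0 N) (b : HiggsLattice.PBond P 0) :
    ‖covDeriv C A (propagatorK C Ω A msq a k φ) b‖ ≤ ∑ j ∈ Finset.range k, ‖covDeriv C A (pieceR C Ω A msq a k j φ) b‖ := by
  rw [← sum_pieceR (C := C) (Ω := Ω) (A := A) hm ha hL1 hk hkK, LinearMap.sum_apply,
    B3Ineq210RegularTorus.covDeriv_sum'']
  exact norm_sum_le _ _

/-- transported row difference: `‖U(A(Γ))(D^ε_AG^ε_k(Ω,A)φ)(⟨x₂,μ⟩) − (D^ε_AG^ε_k(Ω,A)φ)(⟨x₁,μ⟩)‖ ≤ Σ_{j<k}‖…G^η_{(j)}(Ω,A)…‖`.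
[cite: Balaban1983Higgs3, (2.6) p.424] -/
theorem norm_hol_covDeriv_G_sub_le_sumR (hm : 0 < msq) (ha : 0 < a) (hL1 : 1 < P.L) (hk : 1 ≤ k) (hkK : k ≤ P.K)
    (φ : ScalarField P 0 N) (x₁ x₂ : HiggsLattice.Site P 0) (Γ : List (HiggsLattice.Site P 0)) (μ : Fin P.d) :
    ‖hol C A x₁ Γ (covDeriv C A (propagatorK C Ω A msq a k φ) ⟨x₂, μ⟩) - covDeriv C A (propagatorK C Ω A msq a k φ) ⟨x₁, μ⟩‖
      ≤ ∑ j ∈ Finset.range k,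
          ‖hol C A x₁ Γ (covDeriv C A (pieceR C Ω A msq a k j φ) ⟨x₂, μ⟩) - covDeriv C A (pieceR C Ω A msq a k j φ) ⟨x₁, μ⟩‖ := by
  rw [← sum_pieceR (C := C) (Ω := Ω) (A := A) hm ha hL1 hk hkK, LinearMap.sum_apply, B3Ineq210RegularTorus.covDeriv_sum'',
    B3Ineq210RegularTorus.covDeriv_sum'', map_sum, ← Finset.sum_sub_distrib]
  exact norm_sum_le _ _

end Pieces

/-! ## §2 The blocks of the kernel of `G_k(Ω, A)` as maps of `ℝ^N`, the row-differentiated blocks, the row move and the column move -/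

section Blocks

variable (C : ChargeData N) (Ω : Finset (HiggsLattice.Site P 0)) (A : HiggsLattice.VecField P 0) (msq a : ℝ) (k : ℕ)

/-- The `N × N` block `G^ε_k(Ω, A; x, x′) : v ↦ (G^ε_k(Ω,A)δ_{x′}v)(x)` of the region kernel, as a map of `ℝ^N` (the typer's
`HiggsCovariance.kernel`, made continuous). [cite: Balaban1982Higgs1, (2.24) p.610] [cite: Balaban1983Higgs3, (3.1) p.432] -/
def blockKR (x x' : HiggsLattice.Site P 0) : E N →L[ℝ] E N :=
  LinearMap.toContinuousLinearMap (HiggsCovariance.kernel (propagatorK C Ω A msq a k) x x')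

/-- The ROW-DIFFERENTIATED block `v ↦ (D^ε_{A}G^ε_k(Ω,A)δ_{x′}v)(b)` = `ε^{−1}(U(A_b)G^ε_k(Ω,A;b₊,x′) − G^ε_k(Ω,A;b₋,x′))`.
[cite: Balaban1982Higgs1, (1.7) p.605] [cite: Balaban1983Higgs3, (1.32) p.420] -/
def blockDKR (b : HiggsLattice.PBond P 0) (x' : HiggsLattice.Site P 0) : E N →L[ℝ] E N :=
  (P.mesh 0)⁻¹ • ((C.U (P.mesh 0) (A b)).comp (blockKR C Ω A msq a k b.tgt x') - blockKR C Ω A msq a k b.src x')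

variable {C Ω A msq a k}

/-- `G^ε_k(Ω,A;x,x′)v = (G^ε_k(Ω,A)δ_{x′}v)(x)`. [cite: Balaban1982Higgs1, (2.24) p.610] -/
theorem blockKR_apply (x x' : HiggsLattice.Site P 0) (v : E N) :
    blockKR C Ω A msq a k x x' v = propagatorK C Ω A msq a k (Pi.single x' v) x := by
  simp [blockKR, HiggsCovariance.kernel]

/-- `(D G^ε_k(Ω,A))(b,x′)v = (D^ε_AG^ε_k(Ω,A)δ_{x′}v)(b)`. [cite: Balaban1982Higgs1, (1.7) p.605] -/
theorem blockDKR_apply (b : HiggsLattice.PBond P 0) (x' : HiggsLattice.Site P 0) (v : E N) :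
    blockDKR C Ω A msq a k b x' v = covDeriv C A (propagatorK C Ω A msq a k (Pi.single x' v)) b := by
  simp only [blockDKR, _root_.smul_apply, _root_.sub_apply, ContinuousLinearMap.comp_apply, blockKR_apply]
  rfl

/-- `‖G^ε_k(Ω,A;x,x′)‖ ≤ Σ_{i′}‖(G^ε_k(Ω,A)e_{(x′,i′)})(x)‖` (operator norm below the column sum). [cite: Balaban1983Higgs3, (3.1) p.432] -/
theorem norm_blockKR_le (x x' : HiggsLattice.Site P 0) :
    ‖blockKR C Ω A msq a k x x'‖ ≤ ∑ i' : Ix N, ‖propagatorK C Ω A msq a k (cb P N 0 (x', i')) x‖ := by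
  refine ContinuousLinearMap.opNorm_le_bound _ (Finset.sum_nonneg fun _ _ => norm_nonneg _) fun v => ?_
  rw [blockKR_apply, mul_comm]
  exact norm_apply_single_le _ x' v x

/-- `‖(DG^ε_k(Ω,A))(b,x′)‖ ≤ Σ_{i′}‖(D^ε_AG^ε_k(Ω,A)e_{(x′,i′)})(b)‖`. [cite: Balaban1983Higgs3, (3.1) p.432] -/
theorem norm_blockDKR_le (b : HiggsLattice.PBond P 0) (x' : HiggsLattice.Site P 0) :
    ‖blockDKR C Ω A msq a k b x'‖ ≤ ∑ i' : Ix N, ‖covDeriv C A (propagatorK C Ω A msq a k (cb P N 0 (x', i'))) b‖ := by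
  refine ContinuousLinearMap.opNorm_le_bound _ (Finset.sum_nonneg fun _ _ => norm_nonneg _) fun v => ?_
  rw [blockDKR_apply, mul_comm]
  exact norm_covDeriv_apply_single_le C A _ x' v b

/-- **The row move**: `‖U(A(Γ))(DG^ε_k(Ω,A))(⟨x₂,μ⟩,y) − (DG^ε_k(Ω,A))(⟨x₁,μ⟩,y)‖ ≤ Σ_{i′}‖U(A(Γ))(D^ε_AG^ε_k(Ω,A)e_{(y,i′)})(⟨x₂,μ⟩) −
(D^ε_AG^ε_k(Ω,A)e_{(y,i′)})(⟨x₁,μ⟩)‖`. [cite: Balaban1983Higgs3, (1.32) p.420] -/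
theorem norm_hol_comp_blockDKR_sub_le (x₁ x₂ y : HiggsLattice.Site P 0) (Γ : List (HiggsLattice.Site P 0)) (μ : Fin P.d) :
    ‖(hol C A x₁ Γ).comp (blockDKR C Ω A msq a k ⟨x₂, μ⟩ y) - blockDKR C Ω A msq a k ⟨x₁, μ⟩ y‖
      ≤ ∑ i' : Ix N, ‖hol C A x₁ Γ (covDeriv C A (propagatorK C Ω A msq a k (cb P N 0 (y, i'))) ⟨x₂, μ⟩)
          - covDeriv C A (propagatorK C Ω A msq a k (cb P N 0 (y, i'))) ⟨x₁, μ⟩‖ := by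
  refine ContinuousLinearMap.opNorm_le_bound _ (Finset.sum_nonneg fun _ _ => norm_nonneg _) fun v => ?_
  rw [_root_.sub_apply, ContinuousLinearMap.comp_apply, blockDKR_apply, blockDKR_apply, mul_comm]
  refine (B3Ineq211RegularTorus.norm_hol_covDeriv_sub_le_sum_coord C A _ _ x₁ x₂ Γ μ).trans ?_
  rw [Fintype.sum_prod_type, Finset.sum_eq_single y, Finset.mul_sum]
  · exact Finset.sum_le_sum fun i' _ => mul_le_mul_of_nonneg_right (abs_fieldCoord_single_le y v _) (norm_nonneg _)
  · intro x _ hx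
    exact Finset.sum_eq_zero fun i' _ => by rw [fieldCoord_single_of_ne y v (s := (x, i')) hx, abs_zero, zero_mul]
  · intro h; exact absurd (Finset.mem_univ y) h

/-- **The column move** (the path lemma on the column field `ε^{−1}G^ε_k(Ω,A)(dip_b w)`): for a chain `Γ′` from `y₁` to `y₂` inside a
set `S` on whose bonds `‖(D^ε_AG^ε_k(Ω,A) dip_b w)(c)‖ ≤ M_×‖w‖`, `‖(DG^ε_k)(b,y₂)∘U(A(Γ′))^* − (DG^ε_k)(b,y₁)‖ ≤ |Γ′|·M_×` — the adjoint
identity `⟨w,(DG^ε_kδ_yv)(b)⟩ = ε^{−1}⟨(G^ε_k dip_b w)(y), v⟩` turns the difference into `ε^{−1}⟨U(A(Γ′))ψ(y₂) − ψ(y₁), v⟩`, `ψ = G^ε_k(Ω,A) dip_b w`.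
[cite: Balaban1983Higgs3, (1.32) p.420] [cite: Balaban1983RegularityDecay, p.578] -/
theorem norm_blockDKR_comp_star_sub_le (hS : ∀ μ, 2 < P.sitesPerDir 0 μ) (b : HiggsLattice.PBond P 0)
    (S : Finset (HiggsLattice.Site P 0)) {Mx : ℝ} (hMx : 0 ≤ Mx)
    (hD : ∀ (c : HiggsLattice.PBond P 0) (w : E N), c.src ∈ S → c.tgt ∈ S →
      ‖covDeriv C A (propagatorK C Ω A msq a k (dip C A b w)) c‖ ≤ Mx * ‖w‖)
    {y₁ : HiggsLattice.Site P 0} {Γ' : List (HiggsLattice.Site P 0)} (hch : IsTChain y₁ Γ') (hΓ : ∀ z ∈ y₁ :: Γ', z ∈ S) :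
    ‖(blockDKR C Ω A msq a k b (pathEnd y₁ Γ')).comp (star (hol C A y₁ Γ')) - blockDKR C Ω A msq a k b y₁‖
      ≤ (Γ'.length : ℝ) * Mx := by
  have hε : 0 < P.mesh 0 := P.mesh_pos 0
  refine opNorm_le_of_inner_le _ (by positivity) fun v w => ?_
  set ψ : ScalarField P 0 N := propagatorK C Ω A msq a k (dip C A b w) with hψ
  -- the bilinear form through the column field `ψ`
  have hform : ⟪w, ((blockDKR C Ω A msq a k b (pathEnd y₁ Γ')).comp (star (hol C A y₁ Γ')) - blockDKR C Ω A msq a k b y₁) v⟫_ℝ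
      = (P.mesh 0)⁻¹ * ⟪hol C A y₁ Γ' (ψ (pathEnd y₁ Γ')) - ψ y₁, v⟫_ℝ := by
    rw [_root_.sub_apply, ContinuousLinearMap.comp_apply, inner_sub_right, blockDKR_apply, blockDKR_apply,
      inner_covDeriv_propagatorK_single_R, inner_covDeriv_propagatorK_single_R, ContinuousLinearMap.star_eq_adjoint,
      ContinuousLinearMap.adjoint_inner_right, inner_sub_left, mul_sub]
  rw [hform, abs_mul, abs_of_nonneg (inv_nonneg.mpr hε.le)]
  -- the path lemma on `ψ` inside `S`
  have hpath := norm_hol_apply_sub_le hS C A ψ S (G := Mx * ‖w‖)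
    (fun y μ hy hyμ => hD ⟨y, μ⟩ w hy hyμ) hch hΓ
  have hin : |⟪hol C A y₁ Γ' (ψ (pathEnd y₁ Γ')) - ψ y₁, v⟫_ℝ| ≤ P.mesh 0 * Γ'.length * (Mx * ‖w‖) * ‖v‖ :=
    (abs_real_inner_le_norm _ _).trans (mul_le_mul_of_nonneg_right hpath (norm_nonneg _))
  calc (P.mesh 0)⁻¹ * |⟪hol C A y₁ Γ' (ψ (pathEnd y₁ Γ')) - ψ y₁, v⟫_ℝ|
      ≤ (P.mesh 0)⁻¹ * (P.mesh 0 * Γ'.length * (Mx * ‖w‖) * ‖v‖) := mul_le_mul_of_nonneg_left hin (inv_nonneg.mpr hε.le)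
    _ = (Γ'.length : ℝ) * Mx * ‖v‖ * ‖w‖ * ((P.mesh 0)⁻¹ * P.mesh 0) := by ring
    _ = (Γ'.length : ℝ) * Mx * ‖v‖ * ‖w‖ := by rw [inv_mul_cancel₀ hε.ne', mul_one]

end Blocks

/-! ## §3 The two-variable field `(x,x′) ↦ G_k(Ω,A;x,x′)` on `□(v) × □(v′)`, the norm (1.32), the interior cubes and the carrier -/

section Field

variable (C : ChargeData N) (Ω : Finset (HiggsLattice.Site P 0)) (A : HiggsLattice.VecField P 0) (msq a : ℝ) (k : ℕ)

/-- **The two-variable field of (3.1) on a region** in the print's units for the step `k`: `F(x,x′) = G_k(Ω,A;x,x′) ∈ Hom(ℝ^N_{x′}, ℝ^N_x)`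
(`unitV = (L^kε)^{d−2}ε^{−d}` times the raw block). [cite: Balaban1983Higgs3, (3.1) p.432] -/
def kerFR (z : PSite P) : E N →L[ℝ] E N := unitV P k • blockKR C Ω A msq a k z.1 z.2

/-- **The covariant derivatives of `F` along the product bonds** (row bond: `D^η_{A,μ}` in `x`; column bond: `D^η_{A,ν}` in `x′` of the
column slice `x′ ↦ F(x,x′)^* = G_k(Ω,A;x′,x)`, by the symmetry of the region kernel, p33's `inner_propagatorK_single_comm_R`) — both are the row-differentiated block
of `hb`, times `unitD = (L^kε)^{d−1}ε^{−d}`. [cite: Balaban1983Higgs3, (1.32) p.420] -/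
def derivFR (c : PBd P) : E N →L[ℝ] E N := unitD P k • blockDKR C Ω A msq a k (hb c).1 (hb c).2

/-- **`‖hG_k(Ω,A)h′‖_{1,α}` for the regular-background region instance**: the printed (1.32) SUM form `B3Sect1Statements.norm132` of the
two-variable field `F = G_k(Ω,A;·,·)` on `□(v) × □(v′)` — covariant derivatives in all `2d` directions, transports `U(A(Γ))∘·∘U(A(Γ′))^*`
along the coordinatewise contours (the torus twin's `transp`), Hölder quotients over same-direction product-bond pairs at the sup-distance
`pdist` of their base points, values in `Hom(ℝ^N, ℝ^N)` with the operator norm (the torus twin's reading of «extends in a natural way to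
functions of many variables», p. 420). [cite: Balaban1983Higgs3, (3.1) p.432] -/
def normHGHR (α : ℝ) (v v' : HiggsLattice.Site P k) : ℝ :=
  norm132 α (fun c c' => dirOf c = dirOf c') (fun c c' => pdist k (baseOf c) (baseOf c')) (transp C A)
    (sites k v v') (bonds k v v') (kerFR C Ω A msq a k) (derivFR C Ω A msq a k)

/-- **The interior unit cubes of `Ω` at scale `k`**: the labels `v ∈ T_1^{(k)}` whose unit cube `□(v) = {x : ⌊x/L^k⌋ = v}` consists of
interior points of `Ω` (r14's `Interior k K₀ Ω`: the lattice ball of radius `2r_S + 2L^kK₀(d+1) + 1` lies in `Ω` — the `R₀`-restriction of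
Proposition I.2.1 for the region inputs). [cite: Balaban1983Higgs3, (3.1) p.432] [cite: Balaban1982Higgs1, Prop. 2.1 p.610] -/
def IntCube (k K₀ : ℕ) (Ω : Finset (HiggsLattice.Site P 0)) : Type :=
  {v : HiggsLattice.Site P k // ∀ x : HiggsLattice.Site P 0, blockIter k x = v → Interior k K₀ Ω x}

/-- **The concrete carrier of B3 §3 for a REGION `Ω ⊆ T_η` at a REGULAR NON-CONSTANT background `B̃ = A`** at the scale `k` of the volume
`P`, cube parameter `K₀`: localization functions `LocFn` = the interior unit cubes `□(v)` of p. 420 (`IntCube`), `distCubes = dist(□(v),□(v′))`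
(the torus twin's `cubeDist`), `normHGH α h h′ = ‖hG_k(Ω,A)h′‖_{1,α}` (`normHGHR`); the data of (3.2)–(3.5) are NOT modelled (`RenClass′ = ∅`,
so `Ineq32`, `Ineq33`, `Claim35` are vacuous for this carrier and nothing is claimed about them), `e(L^kε) = λ(L^kε) = 0`.
[cite: Balaban1983Higgs3, (3.1) p.432] -/
def sect3RegRegion (C : ChargeData N) (Ω : Finset (HiggsLattice.Site P 0)) (A : HiggsLattice.VecField P 0) (msq a : ℝ) (k K₀ : ℕ) :
    Sect3Data where
  eRun := 0
  lamRun := 0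
  LocFn := IntCube k K₀ Ω
  distCubes := fun v v' => cubeDist k v.1 v'.1
  normHGH := fun α v v' => normHGHR C Ω A msq a k α v.1 v'.1
  RenClass' := PEmpty
  Loc := fun G => G.elim
  ExtS := PUnit
  ExtV := PUnit
  E' := fun G => G.elim
  E3 := fun G => G.elim
  dv := fun G => G.elim
  ds := fun G => G.elim
  normS := fun _ _ => 0
  normV := fun _ _ => 0
  lhs35 := fun G => G.elim
  GenFamily := fun G => G.elim
  rhs35 := fun G => G.elim
  PosAlongOrderings := fun G => G.elim

variable {C Ω A msq a k}

/-- `(3.1)` for the region carrier unfolds to the bound on `normHGHR` for every pair of interior unit cubes at distance `≥ 1`.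
[cite: Balaban1983Higgs3, (3.1) p.432] -/
theorem ineq31R_iff {K₀ : ℕ} (α δ₀ Cst : ℝ) :
    (sect3RegRegion C Ω A msq a k K₀).Ineq31 α δ₀ Cst ↔
      ∀ v v' : IntCube k K₀ Ω, 1 ≤ cubeDist k v.1 v'.1 →
        normHGHR C Ω A msq a k α v.1 v'.1 ≤ Cst * Real.exp (-(δ₀ * cubeDist k v.1 v'.1)) :=
  Iff.rfl

/-- **For `Ω = T_ε` every unit cube is interior** (r14's `interior_univ`): the whole-torus case carries no restriction on the cubes.
[cite: Balaban1982Higgs1, Prop. 2.1 p.610] -/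
theorem intCube_univ (k K₀ : ℕ) (v : HiggsLattice.Site P k) :
    ∀ x : HiggsLattice.Site P 0, blockIter k x = v → Interior k K₀ (Finset.univ : Finset (HiggsLattice.Site P 0)) x :=
  fun x _ => interior_univ x

/-- The interior cubes of `Ω = T_ε` are all of `T_1^{(k)}`. [cite: Balaban1982Higgs1, Prop. 2.1 p.610] -/
def intCubeUnivEquiv (k K₀ : ℕ) : IntCube (P := P) k K₀ Finset.univ ≃ HiggsLattice.Site P k where
  toFun := fun v => v.1
  invFun := fun v => ⟨v, intCube_univ k K₀ v⟩
  left_inv := fun _ => rfl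
  right_inv := fun _ => rfl

end Field

/-! ## §4 The three parts of `‖hG_k(Ω,A)h′‖_{1,α}` for interior cubes: the sup of the kernel, the sup of its derivatives, the Hölder quotients -/

section Parts

variable {k K₀ : ℕ} {C : ChargeData N} {Ω : Finset (HiggsLattice.Site P 0)} {A : HiggsLattice.VecField P 0} {msq a : ℝ}

/-- **Part 1 — the kernel on `□(v) × □(v′)`** for interior cubes: `|G_k(Ω,A;x,x′)| ≤ C_V·Φ·e^{−(δL/2)dist(□(v),□(v′))}`, from the value clause of
(2.10) at interior points for every piece, summed over the pieces at separated arguments. [cite: Balaban1983Higgs3, (3.1) p.432]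
[cite: Balaban1983Higgs3, (2.10) p.426] -/
theorem sup_part_leR (hL2 : 2 ≤ P.L) (hm : 0 < msq) (ha : 0 < a) (hk1 : 1 ≤ k) (hkK : k ≤ P.K) {δ CV : ℝ} (hδ : 0 < δ)
    (hCV : 0 ≤ CV)
    (hV : ∀ (j : ℕ) (x x' : HiggsLattice.Site P 0), Interior k K₀ Ω x → Interior k K₀ Ω x' →
      (P.mesh 0 ^ P.d)⁻¹ * ∑ i' : Ix N, ‖pieceR C Ω A msq a k j (cb P N 0 (x', i')) x‖
        ≤ CV * (P.mesh j ^ 2 * (P.mesh j ^ P.d)⁻¹) * Real.exp (-(δ * ((HiggsLattice.Site.tdist x x' : ℝ) / (P.L : ℝ) ^ j))))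
    {v v' : HiggsLattice.Site P k} (hv : ∀ x, blockIter k x = v → Interior k K₀ Ω x) (hv' : ∀ x, blockIter k x = v' → Interior k K₀ Ω x)
    (h1 : 1 ≤ cubeDist k v v') {z : PSite P} (hz : z ∈ sites k v v') :
    ‖kerFR C Ω A msq a k z‖ ≤ CV * phiSum P.L (P.d + 1) δ * Real.exp (-(δ * P.L / 2 * cubeDist k v v')) := by
  obtain ⟨hx, hx'⟩ := mem_sites.1 hz
  have hL1 : 1 < P.L := by omega
  have hDc : cubeDist k v v' ≤ (HiggsLattice.Site.tdist z.1 z.2 : ℝ) / (P.L : ℝ) ^ k := cubeDist_le_sepD hkK hx hx' h1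
  have hD1 : 1 ≤ (HiggsLattice.Site.tdist z.1 z.2 : ℝ) / (P.L : ℝ) ^ k := h1.trans hDc
  have hU : 0 ≤ P.mesh k ^ P.d * (P.mesh k ^ 2)⁻¹ := by have := P.mesh_pos k; positivity
  -- the kernel below the pieces (2.6)
  have hker : ‖kerFR C Ω A msq a k z‖
      ≤ ∑ j ∈ Finset.range k, P.mesh k ^ P.d * (P.mesh k ^ 2)⁻¹ *
          ((P.mesh 0 ^ P.d)⁻¹ * ∑ i' : Ix N, ‖pieceR C Ω A msq a k j (cb P N 0 (z.2, i')) z.1‖) := by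
    rw [kerFR, norm_smul, Real.norm_eq_abs, abs_of_pos (unitV_pos P k)]
    calc unitV P k * ‖blockKR C Ω A msq a k z.1 z.2‖
        ≤ unitV P k * ∑ i' : Ix N, ∑ j ∈ Finset.range k, ‖pieceR C Ω A msq a k j (cb P N 0 (z.2, i')) z.1‖ :=
          mul_le_mul_of_nonneg_left ((norm_blockKR_le z.1 z.2).trans (Finset.sum_le_sum fun i' _ =>
            norm_G_apply_le_sumR C Ω A msq a hm ha hL1 hk1 hkK _ z.1)) (unitV_pos P k).le
      _ = _ := by
          rw [Finset.sum_comm, unitV, Finset.mul_sum]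
          exact Finset.sum_congr rfl fun j _ => mul_assoc _ _ _
  refine hker.trans ?_
  have hmain := sum_pieces_sep_le' (k := k) hL2 (p := P.d + 1) hCV zero_le_one hδ hD1 hDc
    (fun j => P.mesh k ^ P.d * (P.mesh k ^ 2)⁻¹ *
      ((P.mesh 0 ^ P.d)⁻¹ * ∑ i' : Ix N, ‖pieceR C Ω A msq a k j (cb P N 0 (z.2, i')) z.1‖))
    (fun j => P.mesh k ^ P.d * (P.mesh k ^ 2)⁻¹ * (P.mesh j ^ 2 * (P.mesh j ^ P.d)⁻¹)) ?_ ?_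
  · rw [mul_one] at hmain; exact hmain
  · intro j hj
    have h := mul_le_mul_of_nonneg_left (hV j z.1 z.2 (hv _ hx) (hv' _ hx')) hU
    rw [div_pow_eq_div_mul_sc (le_of_lt hj)] at h
    refine h.trans (le_of_eq ?_); ring
  · intro j hj; exact weightV_le (le_of_lt hj)

/-- **Part 2 — the covariant derivatives on the product bonds** for interior cubes: `|D^η_{A}G_k(Ω,A;·,·)(c)| ≤ C_V·Φ·e^{−(δL/2)dist}` for row
AND column bonds, from the derivative clause of (2.10) at interior points for every piece. [cite: Balaban1983Higgs3, (3.1) p.432]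
[cite: Balaban1983Higgs3, (2.10) p.426] -/
theorem deriv_part_leR (hL2 : 2 ≤ P.L) (hm : 0 < msq) (ha : 0 < a) (hk1 : 1 ≤ k) (hkK : k ≤ P.K) {δ CV : ℝ} (hδ : 0 < δ)
    (hCV : 0 ≤ CV)
    (hDv : ∀ (j : ℕ) (μ : Fin P.d) (x x' : HiggsLattice.Site P 0), Interior k K₀ Ω x → Interior k K₀ Ω x' →
      (P.mesh 0 ^ P.d)⁻¹ * ∑ i' : Ix N, ‖covDeriv C A (pieceR C Ω A msq a k j (cb P N 0 (x', i'))) ⟨x, μ⟩‖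
        ≤ CV * (P.mesh j * (P.mesh j ^ P.d)⁻¹) * Real.exp (-(δ * ((HiggsLattice.Site.tdist x x' : ℝ) / (P.L : ℝ) ^ j))))
    {v v' : HiggsLattice.Site P k} (hv : ∀ x, blockIter k x = v → Interior k K₀ Ω x) (hv' : ∀ x, blockIter k x = v' → Interior k K₀ Ω x)
    (h1 : 1 ≤ cubeDist k v v') {c : PBd P} (hc : c ∈ bonds k v v') :
    ‖derivFR C Ω A msq a k c‖ ≤ CV * phiSum P.L (P.d + 1) δ * Real.exp (-(δ * P.L / 2 * cubeDist k v v')) := by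
  obtain ⟨hbs, -, hy, -, -⟩ := bonds_spec hc
  have hvb : ∀ x, blockIter k x = cubeB v v' c → Interior k K₀ Ω x := by
    rcases c with c | c
    · exact hv
    · exact hv'
  have hvy : ∀ x, blockIter k x = cubeY v v' c → Interior k K₀ Ω x := by
    rcases c with c | c
    · exact hv'
    · exact hv
  rw [← cubeDist_cubeB_cubeY v v' c] at h1 ⊢
  unfold derivFR
  generalize cubeB v v' c = vb at hbs h1 hvb ⊢
  generalize cubeY v v' c = vy at hy h1 hvy ⊢
  generalize (hb c).1 = b at hbs ⊢
  generalize (hb c).2 = y at hy ⊢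
  obtain ⟨x, μ⟩ := b
  have hL1 : 1 < P.L := by omega
  have hDc : cubeDist k vb vy ≤ (HiggsLattice.Site.tdist x y : ℝ) / (P.L : ℝ) ^ k := cubeDist_le_sepD hkK hbs hy h1
  have hD1 : 1 ≤ (HiggsLattice.Site.tdist x y : ℝ) / (P.L : ℝ) ^ k := h1.trans hDc
  have hU : 0 ≤ P.mesh k ^ P.d * (P.mesh k)⁻¹ := by have := P.mesh_pos k; positivity
  have hker : ‖unitD P k • blockDKR C Ω A msq a k ⟨x, μ⟩ y‖
      ≤ ∑ j ∈ Finset.range k, P.mesh k ^ P.d * (P.mesh k)⁻¹ *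
          ((P.mesh 0 ^ P.d)⁻¹ * ∑ i' : Ix N, ‖covDeriv C A (pieceR C Ω A msq a k j (cb P N 0 (y, i'))) ⟨x, μ⟩‖) := by
    rw [norm_smul, Real.norm_eq_abs, abs_of_pos (unitD_pos P k)]
    calc unitD P k * ‖blockDKR C Ω A msq a k ⟨x, μ⟩ y‖
        ≤ unitD P k * ∑ i' : Ix N, ∑ j ∈ Finset.range k, ‖covDeriv C A (pieceR C Ω A msq a k j (cb P N 0 (y, i'))) ⟨x, μ⟩‖ :=
          mul_le_mul_of_nonneg_left ((norm_blockDKR_le _ y).trans (Finset.sum_le_sum fun i' _ =>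
            norm_covDeriv_G_apply_le_sumR C Ω A msq a hm ha hL1 hk1 hkK _ _)) (unitD_pos P k).le
      _ = _ := by
          rw [Finset.sum_comm, unitD, Finset.mul_sum]
          exact Finset.sum_congr rfl fun j _ => mul_assoc _ _ _
  refine hker.trans ?_
  have hmain := sum_pieces_sep_le' (k := k) hL2 (p := P.d + 1) hCV zero_le_one hδ hD1 hDc
    (fun j => P.mesh k ^ P.d * (P.mesh k)⁻¹ *
      ((P.mesh 0 ^ P.d)⁻¹ * ∑ i' : Ix N, ‖covDeriv C A (pieceR C Ω A msq a k j (cb P N 0 (y, i'))) ⟨x, μ⟩‖))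
    (fun j => P.mesh k ^ P.d * (P.mesh k)⁻¹ * (P.mesh j * (P.mesh j ^ P.d)⁻¹)) ?_ ?_
  · rw [mul_one] at hmain; exact hmain
  · intro j hj
    have h := mul_le_mul_of_nonneg_left (hDv j μ x y (hvb _ hbs) (hvy _ hy)) hU
    rw [div_pow_eq_div_mul_sc (le_of_lt hj)] at h
    refine h.trans (le_of_eq ?_); ring
  · intro j hj; exact weightD_le (le_of_lt hj)

/-- **Part 3a — the column move** `(DG^ε_k(Ω,A))(b,y₂)∘U(A(Γ_{y₁,y₂}))^* − (DG^ε_k(Ω,A))(b,y₁)` for `b` over the interior cube `□(v_b)`,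
`y₁, y₂ ∈ □(v_y)` interior: bounded by `d|y₁−y₂|·M_×`, `M_× = ε^dε·C_M(L^kε)^{−d}Φe^{−(δL/2)dist}` the bound of the twice-differentiated kernel
(the mixed clause of (2.10) at interior points) on the bonds of `□(v_y)` (the contour stays in the cube). [cite: Balaban1983Higgs3, (1.32) p.420]
[cite: Balaban1983Higgs3, (2.10) p.426] -/
theorem termA_leR (hS : ∀ μ, 2 < P.sitesPerDir 0 μ) (hL2 : 2 ≤ P.L) (hm : 0 < msq) (ha : 0 < a) (hk1 : 1 ≤ k) (hkK : k ≤ P.K)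
    {δ CM : ℝ} (hδ : 0 < δ) (hCM : 0 ≤ CM)
    (hM : ∀ (j : ℕ) (μ ν : Fin P.d) (x x' : HiggsLattice.Site P 0), Interior k K₀ Ω x → Interior k K₀ Ω x' →
      mixedTermR C Ω A msq a k j μ ν x x'
        ≤ CM * (P.mesh j ^ P.d)⁻¹ * Real.exp (-(δ * ((HiggsLattice.Site.tdist x x' : ℝ) / (P.L : ℝ) ^ j))))
    {vb vy : HiggsLattice.Site P k} (hvb : ∀ x, blockIter k x = vb → Interior k K₀ Ω x)
    (hvy : ∀ x, blockIter k x = vy → Interior k K₀ Ω x) (h1 : 1 ≤ cubeDist k vb vy) {b : HiggsLattice.PBond P 0}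
    (hbv : blockIter k b.src = vb) {y₁ y₂ : HiggsLattice.Site P 0} (hy₁ : blockIter k y₁ = vy) (hy₂ : blockIter k y₂ = vy) :
    ‖(blockDKR C Ω A msq a k b y₂).comp (star (hol C A y₁ (cpath y₁ y₂))) - blockDKR C Ω A msq a k b y₁‖
      ≤ (P.d : ℝ) * (HiggsLattice.Site.tdist y₁ y₂ : ℝ) *
          (P.mesh 0 ^ P.d * P.mesh 0 *
            (CM * (P.mesh k ^ P.d)⁻¹ * phiSum P.L (P.d + 1) δ * Real.exp (-(δ * P.L / 2 * cubeDist k vb vy)))) := by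
  classical
  obtain ⟨xb, ν⟩ := b
  replace hbv : blockIter k xb = vb := hbv
  have hL1 : 1 < P.L := by omega
  have hε : 0 ≤ P.mesh 0 ^ P.d * P.mesh 0 := by have := P.mesh_pos 0; positivity
  obtain ⟨Mx, hMx⟩ : ∃ Mx : ℝ, Mx = P.mesh 0 ^ P.d * P.mesh 0 *
      (CM * (P.mesh k ^ P.d)⁻¹ * phiSum P.L (P.d + 1) δ * Real.exp (-(δ * P.L / 2 * cubeDist k vb vy))) := ⟨_, rfl⟩
  have hMx0 : 0 ≤ Mx := by
    rw [hMx]; have := P.mesh_pos k; have := phiSum_pos (L := P.L) (P.d + 1) hδ; positivity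
  obtain ⟨S, hS'⟩ : ∃ S : Finset (HiggsLattice.Site P 0), S = Finset.univ.filter fun z => blockIter k z = vy := ⟨_, rfl⟩
  have hadm := isAdm_cpath y₁ y₂
  -- the column field's covariant derivatives on the bonds of `□(v_y)`
  have hD : ∀ (c : HiggsLattice.PBond P 0) (w : E N), c.src ∈ S → c.tgt ∈ S →
      ‖covDeriv C A (propagatorK C Ω A msq a k (dip C A ⟨xb, ν⟩ w)) c‖ ≤ Mx * ‖w‖ := by
    intro c w hc _
    obtain ⟨xc, μ⟩ := c
    have hcv : blockIter k xc = vy := by rw [hS', Finset.mem_filter] at hc; exact hc.2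
    have h1' : 1 ≤ cubeDist k vy vb := by rwa [cubeDist_comm]
    have hDc : cubeDist k vb vy ≤ (HiggsLattice.Site.tdist xc xb : ℝ) / (P.L : ℝ) ^ k := by
      rw [cubeDist_comm]; exact cubeDist_le_sepD hkK hcv hbv h1'
    have hD1 : 1 ≤ (HiggsLattice.Site.tdist xc xb : ℝ) / (P.L : ℝ) ^ k := h1'.trans (cubeDist_le_sepD hkK hcv hbv h1')
    have hsum : ∑ i : Ix N, ‖covDeriv C A (propagatorK C Ω A msq a k (dip C A ⟨xb, ν⟩ (onb N i))) ⟨xc, μ⟩‖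
        ≤ ∑ j ∈ Finset.range k, P.mesh 0 ^ P.d * P.mesh 0 * mixedTermR C Ω A msq a k j μ ν xc xb := by
      calc ∑ i : Ix N, ‖covDeriv C A (propagatorK C Ω A msq a k (dip C A ⟨xb, ν⟩ (onb N i))) ⟨xc, μ⟩‖
          ≤ ∑ i : Ix N, ∑ j ∈ Finset.range k, ‖covDeriv C A (pieceR C Ω A msq a k j (dip C A ⟨xb, ν⟩ (onb N i))) ⟨xc, μ⟩‖ :=
            Finset.sum_le_sum fun i _ => norm_covDeriv_G_apply_le_sumR C Ω A msq a hm ha hL1 hk1 hkK _ _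
        _ = _ := by
            rw [Finset.sum_comm]
            refine Finset.sum_congr rfl fun j _ => ?_
            have hε0 : P.mesh 0 ≠ 0 := (P.mesh_pos 0).ne'
            rw [mixedTermR]
            field_simp
    calc ‖covDeriv C A (propagatorK C Ω A msq a k (dip C A ⟨xb, ν⟩ w)) ⟨xc, μ⟩‖
        ≤ ‖w‖ * ∑ i : Ix N, ‖covDeriv C A (propagatorK C Ω A msq a k (dip C A ⟨xb, ν⟩ (onb N i))) ⟨xc, μ⟩‖ :=
          norm_covDeriv_dip_le_sum (propagatorK C Ω A msq a k) _ _ w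
      _ ≤ ‖w‖ * ∑ j ∈ Finset.range k, P.mesh 0 ^ P.d * P.mesh 0 * mixedTermR C Ω A msq a k j μ ν xc xb :=
          mul_le_mul_of_nonneg_left hsum (norm_nonneg _)
      _ ≤ ‖w‖ * Mx := by
          refine mul_le_mul_of_nonneg_left ?_ (norm_nonneg _)
          have hmain := sum_pieces_sep_le' (k := k) hL2 (p := P.d + 1) (mul_nonneg hε hCM)
            (inv_nonneg.mpr (pow_nonneg (P.mesh_pos k).le P.d)) hδ hD1 hDc
            (fun j => P.mesh 0 ^ P.d * P.mesh 0 * mixedTermR C Ω A msq a k j μ ν xc xb)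
            (fun j => (P.mesh j ^ P.d)⁻¹) ?_ ?_
          · refine hmain.trans (le_of_eq ?_); rw [hMx]; ring
          · intro j hj
            have h := mul_le_mul_of_nonneg_left (hM j μ ν xc xb (hvy _ hcv) (hvb _ hbv)) hε
            rw [div_pow_eq_div_mul_sc (le_of_lt hj)] at h
            refine h.trans (le_of_eq ?_); ring
          · intro j hj; exact weightM_le (le_of_lt hj)
      _ = Mx * ‖w‖ := mul_comm _ _
  have h := norm_blockDKR_comp_star_sub_le (Ω := Ω) (msq := msq) (a := a) (k := k) hS ⟨xb, ν⟩ S hMx0 hD hadm.1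
    (fun z hz => by rw [hS', Finset.mem_filter]; exact ⟨Finset.mem_univ _, blockIter_eq_of_mem_cpath hkK hy₁ hy₂ z hz⟩)
  rw [pathEnd_cpath] at h
  rw [← hMx]
  exact h.trans (mul_le_mul_of_nonneg_right hadm.2.2 hMx0)

/-- **Part 3b — the row move** `U(A(Γ_{x₁,x₂}))(DG^ε_k(Ω,A))(⟨x₂,μ⟩,y) − (DG^ε_k(Ω,A))(⟨x₁,μ⟩,y)` in the print's units, `x₁, x₂ ∈ □(v_b)`,
`y ∈ □(v_y)`, both cubes interior: bounded by `p^α·C_H·Φ·e^{−(δL/2)dist}` for any `p ≥ |x₁−x₂|/L^k`, from (2.11) at interior points for every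
piece along the contour `Γ_{x₁,x₂}` (p35's `holderTermR`). [cite: Balaban1983Higgs3, (1.32) p.420] [cite: Balaban1983Higgs3, (2.11) p.426] -/
theorem termB_leR (hL2 : 2 ≤ P.L) (hm : 0 < msq) (ha : 0 < a) (hk1 : 1 ≤ k) (hkK : k ≤ P.K) {α δ CH : ℝ} (hα0 : 0 ≤ α)
    (hα1 : α ≤ 1) (hδ : 0 < δ) (hCH : 0 ≤ CH)
    (hH : ∀ (j : ℕ) (μ : Fin P.d) (x₁ x₂ x : HiggsLattice.Site P 0) (Γ : List (HiggsLattice.Site P 0)),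
      Interior k K₀ Ω x₁ → Interior k K₀ Ω x₂ → Interior k K₀ Ω x → x₁ ≠ x₂ → IsAdm x₁ x₂ Γ →
      holderTermR C Ω A msq a k j μ x₁ x₂ x Γ
        ≤ (P.mesh 0 * (HiggsLattice.Site.tdist x₁ x₂ : ℝ)) ^ α *
          (CH * (P.mesh j * (P.mesh j ^ P.d)⁻¹ * (P.mesh j ^ α)⁻¹) *
            Real.exp (-(δ * (min (HiggsLattice.Site.tdist x₁ x : ℝ) (HiggsLattice.Site.tdist x₂ x : ℝ) / (P.L : ℝ) ^ j)))))
    {vb vy : HiggsLattice.Site P k} (hvb : ∀ x, blockIter k x = vb → Interior k K₀ Ω x)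
    (hvy : ∀ x, blockIter k x = vy → Interior k K₀ Ω x) (h1 : 1 ≤ cubeDist k vb vy) {x₁ x₂ y : HiggsLattice.Site P 0} (μ : Fin P.d)
    (hx₁ : blockIter k x₁ = vb) (hx₂ : blockIter k x₂ = vb) (hy : blockIter k y = vy) {pd : ℝ}
    (hpd : (HiggsLattice.Site.tdist x₁ x₂ : ℝ) / (P.L : ℝ) ^ k ≤ pd) :
    unitD P k * ‖(hol C A x₁ (cpath x₁ x₂)).comp (blockDKR C Ω A msq a k ⟨x₂, μ⟩ y) - blockDKR C Ω A msq a k ⟨x₁, μ⟩ y‖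
      ≤ pd ^ α * (CH * phiSum P.L (P.d + 1) δ * Real.exp (-(δ * P.L / 2 * cubeDist k vb vy))) := by
  have hL1 : 1 < P.L := by omega
  have hL0 : (0 : ℝ) < P.L := by exact_mod_cast (by omega : 0 < P.L)
  have hLk : (0 : ℝ) < (P.L : ℝ) ^ k := pow_pos hL0 k
  have hpd0 : 0 ≤ pd := le_trans (by positivity) hpd
  have hΦ := phiSum_pos (L := P.L) (P.d + 1) hδ
  by_cases hx : x₁ = x₂
  · subst hx
    rw [cpath_self, hol_nil, ContinuousLinearMap.one_def, ContinuousLinearMap.id_comp, sub_self, norm_zero, mul_zero]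
    positivity
  have hDc : cubeDist k vb vy
      ≤ min (HiggsLattice.Site.tdist x₁ y : ℝ) (HiggsLattice.Site.tdist x₂ y : ℝ) / (P.L : ℝ) ^ k := by
    rcases min_choice (HiggsLattice.Site.tdist x₁ y : ℝ) (HiggsLattice.Site.tdist x₂ y : ℝ) with h | h <;> rw [h]
    · exact cubeDist_le_sepD hkK hx₁ hy h1
    · exact cubeDist_le_sepD hkK hx₂ hy h1
  have hD1 : 1 ≤ min (HiggsLattice.Site.tdist x₁ y : ℝ) (HiggsLattice.Site.tdist x₂ y : ℝ) / (P.L : ℝ) ^ k := h1.trans hDc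
  have hU : 0 ≤ P.mesh k ^ P.d * (P.mesh k)⁻¹ := by have := P.mesh_pos k; positivity
  -- below the pieces (2.6)
  have hstep : unitD P k * ‖(hol C A x₁ (cpath x₁ x₂)).comp (blockDKR C Ω A msq a k ⟨x₂, μ⟩ y) - blockDKR C Ω A msq a k ⟨x₁, μ⟩ y‖
      ≤ ∑ j ∈ Finset.range k, P.mesh k ^ P.d * (P.mesh k)⁻¹ * holderTermR C Ω A msq a k j μ x₁ x₂ y (cpath x₁ x₂) := by
    calc unitD P k * ‖(hol C A x₁ (cpath x₁ x₂)).comp (blockDKR C Ω A msq a k ⟨x₂, μ⟩ y) - blockDKR C Ω A msq a k ⟨x₁, μ⟩ y‖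
        ≤ unitD P k * ∑ i' : Ix N, ∑ j ∈ Finset.range k,
            ‖hol C A x₁ (cpath x₁ x₂) (covDeriv C A (pieceR C Ω A msq a k j (cb P N 0 (y, i'))) ⟨x₂, μ⟩)
              - covDeriv C A (pieceR C Ω A msq a k j (cb P N 0 (y, i'))) ⟨x₁, μ⟩‖ :=
          mul_le_mul_of_nonneg_left ((norm_hol_comp_blockDKR_sub_le x₁ x₂ y _ μ).trans (Finset.sum_le_sum fun i' _ =>
            norm_hol_covDeriv_G_sub_le_sumR C Ω A msq a hm ha hL1 hk1 hkK _ x₁ x₂ _ μ)) (unitD_pos P k).le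
      _ = _ := by
          rw [Finset.sum_comm, unitD, Finset.mul_sum]
          refine Finset.sum_congr rfl fun j _ => ?_
          rw [holderTermR, mul_assoc]
  refine hstep.trans ?_
  have hmain := sum_pieces_sep_le' (k := k) hL2 (p := P.d + 1) (mul_nonneg (Real.rpow_nonneg hpd0 α) hCH) zero_le_one hδ
    hD1 hDc (fun j => P.mesh k ^ P.d * (P.mesh k)⁻¹ * holderTermR C Ω A msq a k j μ x₁ x₂ y (cpath x₁ x₂))
    (fun j => ((P.L : ℝ) ^ (k - j)) ^ α * (P.mesh k ^ P.d * (P.mesh k)⁻¹ * (P.mesh j * (P.mesh j ^ P.d)⁻¹))) ?_ ?_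
  · refine hmain.trans (le_of_eq ?_); ring
  · intro j hj
    have hjk := le_of_lt hj
    have h := mul_le_mul_of_nonneg_left
      (hH j μ x₁ x₂ y _ (hvb _ hx₁) (hvb _ hx₂) (hvy _ hy) hx (isAdm_cpath x₁ x₂)) hU
    rw [div_pow_eq_div_mul_sc hjk] at h
    -- the Hölder weight in the print's units: `(ε|x₁−x₂|)^α(L^jε)^{−α} = (|x₁−x₂|/L^k·L^{k−j})^α ≤ p^α(L^{k−j})^α`
    have hr0 : (0 : ℝ) ≤ (P.L : ℝ) ^ (k - j) := by positivity
    have hwt : (P.mesh 0 * (HiggsLattice.Site.tdist x₁ x₂ : ℝ)) ^ α * (P.mesh j ^ α)⁻¹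
        ≤ pd ^ α * ((P.L : ℝ) ^ (k - j)) ^ α := by
      have hε := P.mesh_pos 0
      have hmj := P.mesh_pos j
      rw [← Real.inv_rpow hmj.le, ← Real.mul_rpow (by positivity) (inv_nonneg.mpr hmj.le), ← Real.mul_rpow hpd0 hr0]
      refine Real.rpow_le_rpow (by positivity) ?_ hα0
      have e : P.mesh 0 * (HiggsLattice.Site.tdist x₁ x₂ : ℝ) * (P.mesh j)⁻¹
          = (HiggsLattice.Site.tdist x₁ x₂ : ℝ) / (P.L : ℝ) ^ k * (P.L : ℝ) ^ (k - j) := by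
        rw [← div_pow_eq_div_mul_sc hjk, mesh_eq_pow_mul P j]
        have hε0 : P.mesh 0 ≠ 0 := hε.ne'
        have hLj : (P.L : ℝ) ^ j ≠ 0 := (pow_pos hL0 j).ne'
        field_simp
      rw [e]
      exact mul_le_mul_of_nonneg_right hpd hr0
    have hrest : 0 ≤ CH * (P.mesh k ^ P.d * (P.mesh k)⁻¹ * (P.mesh j * (P.mesh j ^ P.d)⁻¹)) *
        Real.exp (-(δ * (min (HiggsLattice.Site.tdist x₁ y : ℝ) (HiggsLattice.Site.tdist x₂ y : ℝ) / (P.L : ℝ) ^ k *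
          (P.L : ℝ) ^ (k - j)))) := by
      have := P.mesh_pos k; have := P.mesh_pos j; positivity
    calc P.mesh k ^ P.d * (P.mesh k)⁻¹ * holderTermR C Ω A msq a k j μ x₁ x₂ y (cpath x₁ x₂)
        ≤ _ := h
      _ = (P.mesh 0 * (HiggsLattice.Site.tdist x₁ x₂ : ℝ)) ^ α * (P.mesh j ^ α)⁻¹ *
            (CH * (P.mesh k ^ P.d * (P.mesh k)⁻¹ * (P.mesh j * (P.mesh j ^ P.d)⁻¹)) *
              Real.exp (-(δ * (min (HiggsLattice.Site.tdist x₁ y : ℝ) (HiggsLattice.Site.tdist x₂ y : ℝ) / (P.L : ℝ) ^ k *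
                (P.L : ℝ) ^ (k - j))))) := by ring
      _ ≤ pd ^ α * ((P.L : ℝ) ^ (k - j)) ^ α *
            (CH * (P.mesh k ^ P.d * (P.mesh k)⁻¹ * (P.mesh j * (P.mesh j ^ P.d)⁻¹)) *
              Real.exp (-(δ * (min (HiggsLattice.Site.tdist x₁ y : ℝ) (HiggsLattice.Site.tdist x₂ y : ℝ) / (P.L : ℝ) ^ k *
                (P.L : ℝ) ^ (k - j))))) := mul_le_mul_of_nonneg_right hwt hrest
      _ = _ := by ring
  · intro j hj; exact weightH_le (le_of_lt hj) hα1

/-- **Part 3, the core estimate for one same-direction pair** in explicit variables (interior cubes): bonds `⟨x₁,μ⟩, ⟨x₂,μ⟩` over `□(v_b)`,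
other sites `y₁, y₂ ∈ □(v_y)`: `(L^kε)^{d−1}ε^{−d}‖U(A(Γ_{x₁,x₂}))(DG^ε_k)(⟨x₂,μ⟩,y₂)U(A(Γ_{y₁,y₂}))^* − (DG^ε_k)(⟨x₁,μ⟩,y₁)‖ ≤
(C_H + dC_M)Φe^{−(δL/2)dist}·(max(|x₁−x₂|,|y₁−y₂|)/L^k)^α` — triangle through `(DG^ε_k)(⟨x₂,μ⟩,y₁)`: column move (Part 3a, one factor
`|y₁−y₂|/L^k ≤ p ≤ p^α` as `p ≤ 1` inside a unit cube) plus row move (Part 3b). [cite: Balaban1983Higgs3, (3.1) p.432] -/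
theorem holder_coreR (hS : ∀ μ, 2 < P.sitesPerDir 0 μ) (hL2 : 2 ≤ P.L) (hm : 0 < msq) (ha : 0 < a) (hk1 : 1 ≤ k) (hkK : k ≤ P.K)
    {α δ CH CM : ℝ} (hα0 : 0 ≤ α) (hα1 : α ≤ 1) (hδ : 0 < δ) (hCH : 0 ≤ CH) (hCM : 0 ≤ CM)
    (hH : ∀ (j : ℕ) (μ : Fin P.d) (x₁ x₂ x : HiggsLattice.Site P 0) (Γ : List (HiggsLattice.Site P 0)),
      Interior k K₀ Ω x₁ → Interior k K₀ Ω x₂ → Interior k K₀ Ω x → x₁ ≠ x₂ → IsAdm x₁ x₂ Γ →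
      holderTermR C Ω A msq a k j μ x₁ x₂ x Γ
        ≤ (P.mesh 0 * (HiggsLattice.Site.tdist x₁ x₂ : ℝ)) ^ α *
          (CH * (P.mesh j * (P.mesh j ^ P.d)⁻¹ * (P.mesh j ^ α)⁻¹) *
            Real.exp (-(δ * (min (HiggsLattice.Site.tdist x₁ x : ℝ) (HiggsLattice.Site.tdist x₂ x : ℝ) / (P.L : ℝ) ^ j)))))
    (hM : ∀ (j : ℕ) (μ ν : Fin P.d) (x x' : HiggsLattice.Site P 0), Interior k K₀ Ω x → Interior k K₀ Ω x' →
      mixedTermR C Ω A msq a k j μ ν x x'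
        ≤ CM * (P.mesh j ^ P.d)⁻¹ * Real.exp (-(δ * ((HiggsLattice.Site.tdist x x' : ℝ) / (P.L : ℝ) ^ j))))
    {vb vy : HiggsLattice.Site P k} (hvb : ∀ x, blockIter k x = vb → Interior k K₀ Ω x)
    (hvy : ∀ x, blockIter k x = vy → Interior k K₀ Ω x) (h1 : 1 ≤ cubeDist k vb vy) {x₁ x₂ y₁ y₂ : HiggsLattice.Site P 0}
    (μ : Fin P.d) (hx₁ : blockIter k x₁ = vb) (hx₂ : blockIter k x₂ = vb) (hy₁ : blockIter k y₁ = vy) (hy₂ : blockIter k y₂ = vy)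
    (hpos : 0 < max (HiggsLattice.Site.tdist x₁ x₂ : ℝ) (HiggsLattice.Site.tdist y₁ y₂ : ℝ) / (P.L : ℝ) ^ k) :
    ‖(hol C A x₁ (cpath x₁ x₂)).comp
          ((unitD P k • blockDKR C Ω A msq a k ⟨x₂, μ⟩ y₂).comp (star (hol C A y₁ (cpath y₁ y₂))))
        - unitD P k • blockDKR C Ω A msq a k ⟨x₁, μ⟩ y₁‖
      ≤ (CH + P.d * CM) * phiSum P.L (P.d + 1) δ * Real.exp (-(δ * P.L / 2 * cubeDist k vb vy)) *
          (max (HiggsLattice.Site.tdist x₁ x₂ : ℝ) (HiggsLattice.Site.tdist y₁ y₂ : ℝ) / (P.L : ℝ) ^ k) ^ α := by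
  have hL0 : (0 : ℝ) < P.L := by exact_mod_cast (by omega : 0 < P.L)
  have hLk : (0 : ℝ) < (P.L : ℝ) ^ k := pow_pos hL0 k
  have hΦ := phiSum_pos (L := P.L) (P.d + 1) hδ
  obtain ⟨pd, hpd⟩ : ∃ pd : ℝ,
      pd = max (HiggsLattice.Site.tdist x₁ x₂ : ℝ) (HiggsLattice.Site.tdist y₁ y₂ : ℝ) / (P.L : ℝ) ^ k := ⟨_, rfl⟩
  rw [← hpd] at hpos ⊢
  have htb : (HiggsLattice.Site.tdist x₁ x₂ : ℝ) / (P.L : ℝ) ^ k ≤ pd := by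
    rw [hpd]; exact div_le_div_of_nonneg_right (le_max_left _ _) hLk.le
  have hty : (HiggsLattice.Site.tdist y₁ y₂ : ℝ) / (P.L : ℝ) ^ k ≤ pd := by
    rw [hpd]; exact div_le_div_of_nonneg_right (le_max_right _ _) hLk.le
  have hpd1 : pd ≤ 1 := by
    rw [hpd, div_le_one hLk]
    have h₁ := tdist_le_of_same_cube hkK hx₁ hx₂
    have h₂ := tdist_le_of_same_cube hkK hy₁ hy₂
    exact max_le (by linarith) (by linarith)
  have hpdα : pd ≤ pd ^ α := by
    conv_lhs => rw [← Real.rpow_one pd]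
    exact Real.rpow_le_rpow_of_exponent_ge hpos hpd1 hα1
  -- the unit out, the triangle through `(DG^ε_k)(⟨x₂,μ⟩,y₁)`
  have e : (hol C A x₁ (cpath x₁ x₂)).comp
          ((unitD P k • blockDKR C Ω A msq a k ⟨x₂, μ⟩ y₂).comp (star (hol C A y₁ (cpath y₁ y₂))))
        - unitD P k • blockDKR C Ω A msq a k ⟨x₁, μ⟩ y₁
      = unitD P k • ((hol C A x₁ (cpath x₁ x₂)).comp
          ((blockDKR C Ω A msq a k ⟨x₂, μ⟩ y₂).comp (star (hol C A y₁ (cpath y₁ y₂))) - blockDKR C Ω A msq a k ⟨x₂, μ⟩ y₁) +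
        ((hol C A x₁ (cpath x₁ x₂)).comp (blockDKR C Ω A msq a k ⟨x₂, μ⟩ y₁) - blockDKR C Ω A msq a k ⟨x₁, μ⟩ y₁)) := by
    rw [ContinuousLinearMap.smul_comp, ContinuousLinearMap.comp_smul, ContinuousLinearMap.comp_sub, sub_add_sub_cancel,
      smul_sub]
  rw [e, norm_smul, Real.norm_eq_abs, abs_of_pos (unitD_pos P k)]
  have hA := termA_leR (msq := msq) (a := a) hS hL2 hm ha hk1 hkK hδ hCM hM hvb hvy h1 (b := ⟨x₂, μ⟩) hx₂ hy₁ hy₂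
  have hB := termB_leR (msq := msq) (a := a) hL2 hm ha hk1 hkK hα0 hα1 hδ hCH hH hvb hvy h1 μ hx₁ hx₂ hy₁ htb
  have hu : unitD P k * (P.mesh 0 ^ P.d * P.mesh 0) * (P.mesh k ^ P.d)⁻¹ = ((P.L : ℝ) ^ k)⁻¹ := by
    unfold unitD
    rw [mesh_eq_pow_mul P k]
    have hε0 : P.mesh 0 ≠ 0 := (P.mesh_pos 0).ne'
    have hLk0 : (P.L : ℝ) ^ k ≠ 0 := hLk.ne'
    field_simp
  -- name the two operator differences (column move `TA`, row move `TB`)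
  obtain ⟨TA, hTA⟩ : ∃ T : E N →L[ℝ] E N,
      (blockDKR C Ω A msq a k ⟨x₂, μ⟩ y₂).comp (star (hol C A y₁ (cpath y₁ y₂))) - blockDKR C Ω A msq a k ⟨x₂, μ⟩ y₁ = T :=
    ⟨_, rfl⟩
  obtain ⟨TB, hTB⟩ : ∃ T : E N →L[ℝ] E N,
      (hol C A x₁ (cpath x₁ x₂)).comp (blockDKR C Ω A msq a k ⟨x₂, μ⟩ y₁) - blockDKR C Ω A msq a k ⟨x₁, μ⟩ y₁ = T := ⟨_, rfl⟩
  rw [hTA] at hA ⊢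
  rw [hTB] at hB ⊢
  have hu0 := (unitD_pos P k).le
  have hX : ‖(hol C A x₁ (cpath x₁ x₂)).comp TA‖ ≤ ‖TA‖ := norm_hol_comp_le _ _ _
  have hK0 : 0 ≤ CM * phiSum P.L (P.d + 1) δ * Real.exp (-(δ * P.L / 2 * cubeDist k vb vy)) := by positivity
  calc unitD P k * ‖(hol C A x₁ (cpath x₁ x₂)).comp TA + TB‖
      ≤ unitD P k * (‖TA‖ + ‖TB‖) := mul_le_mul_of_nonneg_left ((norm_add_le _ _).trans (add_le_add hX le_rfl)) hu0
    _ = unitD P k * ‖TA‖ + unitD P k * ‖TB‖ := mul_add _ _ _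
    _ ≤ unitD P k * ((P.d : ℝ) * (HiggsLattice.Site.tdist y₁ y₂ : ℝ) * (P.mesh 0 ^ P.d * P.mesh 0 *
            (CM * (P.mesh k ^ P.d)⁻¹ * phiSum P.L (P.d + 1) δ * Real.exp (-(δ * P.L / 2 * cubeDist k vb vy))))) +
          pd ^ α * (CH * phiSum P.L (P.d + 1) δ * Real.exp (-(δ * P.L / 2 * cubeDist k vb vy))) :=
        add_le_add (mul_le_mul_of_nonneg_left hA hu0) hB
    _ = (P.d : ℝ) * ((HiggsLattice.Site.tdist y₁ y₂ : ℝ) * (unitD P k * (P.mesh 0 ^ P.d * P.mesh 0) * (P.mesh k ^ P.d)⁻¹)) *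
            (CM * phiSum P.L (P.d + 1) δ * Real.exp (-(δ * P.L / 2 * cubeDist k vb vy))) +
          pd ^ α * (CH * phiSum P.L (P.d + 1) δ * Real.exp (-(δ * P.L / 2 * cubeDist k vb vy))) := by ring
    _ = (P.d : ℝ) * ((HiggsLattice.Site.tdist y₁ y₂ : ℝ) / (P.L : ℝ) ^ k) *
            (CM * phiSum P.L (P.d + 1) δ * Real.exp (-(δ * P.L / 2 * cubeDist k vb vy))) +
          pd ^ α * (CH * phiSum P.L (P.d + 1) δ * Real.exp (-(δ * P.L / 2 * cubeDist k vb vy))) := by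
        rw [hu]; ring
    _ ≤ (P.d : ℝ) * pd ^ α * (CM * phiSum P.L (P.d + 1) δ * Real.exp (-(δ * P.L / 2 * cubeDist k vb vy))) +
          pd ^ α * (CH * phiSum P.L (P.d + 1) δ * Real.exp (-(δ * P.L / 2 * cubeDist k vb vy))) :=
        add_le_add (mul_le_mul_of_nonneg_right
          (mul_le_mul_of_nonneg_left (hty.trans hpdα) (Nat.cast_nonneg _)) hK0) le_rfl
    _ = _ := by ring

/-- **Part 3 — the Hölder quotients of (1.32) for the two-variable field on a region**: for same-direction product bonds `c, c′` of
`□(v) × □(v′)` (interior cubes) at positive distance, `‖τ_{c,c′}(DF(c′)) − DF(c)‖ ≤ (C_H + dC_M)Φe^{−(δL/2)dist(□(v),□(v′))}·|z(c) − z(c′)|^α` (row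
pairs and column pairs alike, by the symmetry of the kernel). [cite: Balaban1983Higgs3, (3.1) p.432] [cite: Balaban1983Higgs3, (1.32) p.420] -/
theorem holder_part_leR (hS : ∀ μ, 2 < P.sitesPerDir 0 μ) (hL2 : 2 ≤ P.L) (hm : 0 < msq) (ha : 0 < a) (hk1 : 1 ≤ k)
    (hkK : k ≤ P.K) {α δ CH CM : ℝ} (hα0 : 0 ≤ α) (hα1 : α ≤ 1) (hδ : 0 < δ) (hCH : 0 ≤ CH) (hCM : 0 ≤ CM)
    (hH : ∀ (j : ℕ) (μ : Fin P.d) (x₁ x₂ x : HiggsLattice.Site P 0) (Γ : List (HiggsLattice.Site P 0)),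
      Interior k K₀ Ω x₁ → Interior k K₀ Ω x₂ → Interior k K₀ Ω x → x₁ ≠ x₂ → IsAdm x₁ x₂ Γ →
      holderTermR C Ω A msq a k j μ x₁ x₂ x Γ
        ≤ (P.mesh 0 * (HiggsLattice.Site.tdist x₁ x₂ : ℝ)) ^ α *
          (CH * (P.mesh j * (P.mesh j ^ P.d)⁻¹ * (P.mesh j ^ α)⁻¹) *
            Real.exp (-(δ * (min (HiggsLattice.Site.tdist x₁ x : ℝ) (HiggsLattice.Site.tdist x₂ x : ℝ) / (P.L : ℝ) ^ j)))))
    (hM : ∀ (j : ℕ) (μ ν : Fin P.d) (x x' : HiggsLattice.Site P 0), Interior k K₀ Ω x → Interior k K₀ Ω x' →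
      mixedTermR C Ω A msq a k j μ ν x x'
        ≤ CM * (P.mesh j ^ P.d)⁻¹ * Real.exp (-(δ * ((HiggsLattice.Site.tdist x x' : ℝ) / (P.L : ℝ) ^ j))))
    {v v' : HiggsLattice.Site P k} (hv : ∀ x, blockIter k x = v → Interior k K₀ Ω x) (hv' : ∀ x, blockIter k x = v' → Interior k K₀ Ω x)
    (h1 : 1 ≤ cubeDist k v v') {c c' : PBd P} (hc : c ∈ bonds k v v') (hc' : c' ∈ bonds k v v')
    (hdir : dirOf c = dirOf c') (hpos : 0 < pdist k (baseOf c) (baseOf c')) :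
    ‖transp C A c c' (derivFR C Ω A msq a k c') - derivFR C Ω A msq a k c‖
      ≤ (CH + P.d * CM) * phiSum P.L (P.d + 1) δ * Real.exp (-(δ * P.L / 2 * cubeDist k v v')) *
          pdist k (baseOf c) (baseOf c') ^ α := by
  obtain ⟨hcx₁, -, hcy₁, -, -⟩ := bonds_spec hc
  obtain ⟨hcx₂, -, hcy₂, -, -⟩ := bonds_spec hc'
  rcases c with ⟨μ, x₁, y₁⟩ | ⟨μ, y₁, x₁⟩ <;> rcases c' with ⟨μ', x₂, y₂⟩ | ⟨μ', y₂, x₂⟩ <;>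
    simp only [dirOf, Sum.elim_inl, Sum.elim_inr, Sum.inl.injEq, Sum.inr.injEq, reduceCtorEq] at hdir <;> subst hdir
  · -- a ROW pair: bonds over `□(v)`, other sites in `□(v′)`
    simp only [hb, cubeB, cubeY, Sum.elim_inl] at hcx₁ hcy₁ hcx₂ hcy₂
    exact holder_coreR hS hL2 hm ha hk1 hkK hα0 hα1 hδ hCH hCM hH hM hv hv' h1 μ hcx₁ hcx₂ hcy₁ hcy₂ hpos
  · -- a COLUMN pair: bonds over `□(v′)`, other sites in `□(v)`
    simp only [hb, cubeB, cubeY, Sum.elim_inr] at hcx₁ hcy₁ hcx₂ hcy₂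
    have h1' : 1 ≤ cubeDist k v' v := by rwa [cubeDist_comm]
    change 0 < max (HiggsLattice.Site.tdist y₁ y₂ : ℝ) (HiggsLattice.Site.tdist x₁ x₂ : ℝ) / (P.L : ℝ) ^ k at hpos
    rw [max_comm] at hpos
    have h := holder_coreR hS hL2 hm ha hk1 hkK hα0 hα1 hδ hCH hCM hH hM hv' hv h1' μ hcx₁ hcx₂ hcy₁ hcy₂ hpos
    rw [cubeDist_comm] at h
    change _ ≤ _ * (max (HiggsLattice.Site.tdist y₁ y₂ : ℝ) (HiggsLattice.Site.tdist x₁ x₂ : ℝ) / (P.L : ℝ) ^ k) ^ α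
    rw [max_comm]
    exact h

/-- **`‖hG_k(Ω,A)h′‖_{1,α} ≤ (2C_V + C_H + dC_M)·Φ·e^{−(δL/2)dist(□(v),□(v′))}`** for interior cubes, given the four model-form inputs at
interior points (value, derivative, Hölder, mixed) with a common rate `δ`. [cite: Balaban1983Higgs3, (3.1) p.432] -/
theorem normHGHR_le (hS : ∀ μ, 2 < P.sitesPerDir 0 μ) (hL2 : 2 ≤ P.L) (hm : 0 < msq) (ha : 0 < a) (hk1 : 1 ≤ k) (hkK : k ≤ P.K)
    {α δ CV CH CM : ℝ} (hα0 : 0 ≤ α) (hα1 : α ≤ 1) (hδ : 0 < δ) (hCV : 0 ≤ CV) (hCH : 0 ≤ CH) (hCM : 0 ≤ CM)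
    (hV : ∀ (j : ℕ) (x x' : HiggsLattice.Site P 0), Interior k K₀ Ω x → Interior k K₀ Ω x' →
      (P.mesh 0 ^ P.d)⁻¹ * ∑ i' : Ix N, ‖pieceR C Ω A msq a k j (cb P N 0 (x', i')) x‖
        ≤ CV * (P.mesh j ^ 2 * (P.mesh j ^ P.d)⁻¹) * Real.exp (-(δ * ((HiggsLattice.Site.tdist x x' : ℝ) / (P.L : ℝ) ^ j))))
    (hDv : ∀ (j : ℕ) (μ : Fin P.d) (x x' : HiggsLattice.Site P 0), Interior k K₀ Ω x → Interior k K₀ Ω x' →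
      (P.mesh 0 ^ P.d)⁻¹ * ∑ i' : Ix N, ‖covDeriv C A (pieceR C Ω A msq a k j (cb P N 0 (x', i'))) ⟨x, μ⟩‖
        ≤ CV * (P.mesh j * (P.mesh j ^ P.d)⁻¹) * Real.exp (-(δ * ((HiggsLattice.Site.tdist x x' : ℝ) / (P.L : ℝ) ^ j))))
    (hH : ∀ (j : ℕ) (μ : Fin P.d) (x₁ x₂ x : HiggsLattice.Site P 0) (Γ : List (HiggsLattice.Site P 0)),
      Interior k K₀ Ω x₁ → Interior k K₀ Ω x₂ → Interior k K₀ Ω x → x₁ ≠ x₂ → IsAdm x₁ x₂ Γ →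
      holderTermR C Ω A msq a k j μ x₁ x₂ x Γ
        ≤ (P.mesh 0 * (HiggsLattice.Site.tdist x₁ x₂ : ℝ)) ^ α *
          (CH * (P.mesh j * (P.mesh j ^ P.d)⁻¹ * (P.mesh j ^ α)⁻¹) *
            Real.exp (-(δ * (min (HiggsLattice.Site.tdist x₁ x : ℝ) (HiggsLattice.Site.tdist x₂ x : ℝ) / (P.L : ℝ) ^ j)))))
    (hM : ∀ (j : ℕ) (μ ν : Fin P.d) (x x' : HiggsLattice.Site P 0), Interior k K₀ Ω x → Interior k K₀ Ω x' →
      mixedTermR C Ω A msq a k j μ ν x x'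
        ≤ CM * (P.mesh j ^ P.d)⁻¹ * Real.exp (-(δ * ((HiggsLattice.Site.tdist x x' : ℝ) / (P.L : ℝ) ^ j))))
    {v v' : HiggsLattice.Site P k} (hv : ∀ x, blockIter k x = v → Interior k K₀ Ω x) (hv' : ∀ x, blockIter k x = v' → Interior k K₀ Ω x)
    (h1 : 1 ≤ cubeDist k v v') :
    normHGHR C Ω A msq a k α v v'
      ≤ (2 * CV + CH + P.d * CM) * phiSum P.L (P.d + 1) δ * Real.exp (-(δ * P.L / 2 * cubeDist k v v')) := by
  have hΦ := phiSum_pos (L := P.L) (P.d + 1) hδ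
  have h₁ := supNorm_le (S := sites k v v') (f := kerFR C Ω A msq a k) (by positivity)
    fun z hz => sup_part_leR hL2 hm ha hk1 hkK hδ hCV hV hv hv' h1 hz
  have h₂ := supNorm_le (S := bonds k v v') (f := derivFR C Ω A msq a k) (by positivity)
    fun c hc => deriv_part_leR hL2 hm ha hk1 hkK hδ hCV hDv hv hv' h1 hc
  have h₃ := holderSeminorm_le (α := α) (adm := fun c c' : PBd P => dirOf c = dirOf c')
    (dist := fun c c' => pdist k (baseOf c) (baseOf c')) (τ := transp C A) (S := bonds k v v') (f := derivFR C Ω A msq a k)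
    (C := (CH + P.d * CM) * phiSum P.L (P.d + 1) δ * Real.exp (-(δ * P.L / 2 * cubeDist k v v'))) (by positivity)
    fun c hc c' hc' hadm hpos => holder_part_leR hS hL2 hm ha hk1 hkK hα0 hα1 hδ hCH hCM hH hM hv hv' h1 hc hc' hadm hpos
  unfold normHGHR norm132
  refine (add_le_add (add_le_add h₁ h₂) h₃).trans (le_of_eq ?_)
  ring

end Parts

/-! ## §5 The assembly: kernel bounds at interior points give (3.1) for the region carrier -/

section Assembly

variable {k K₀ : ℕ} {C : ChargeData N} {Ω : Finset (HiggsLattice.Site P 0)} {A : HiggsLattice.VecField P 0} {msq a : ℝ}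

/-- **Transfer (the analogue of r14's `ineq210_of_boundsR`)**: the four kernel inputs in the model's units at interior points — the value
and row-derivative clauses of (2.10), the Hölder clause (2.11) on admissible contours, the twice-differentiated clause of (2.10) — with the
rates `δ₁, δ₂, δ₃` give **(3.1) for the region carrier** with `δ₀ = δL/2`, `O(1) = (2C_V + C_H + dC_M)Φ_{d+1}(δ, L)`, `δ = min(δ₁, δ₂, δ₃)`,
for every volume with `K ≥ 1`, `L ≥ 2`. [cite: Balaban1983Higgs3, (3.1) p.432] [cite: Balaban1983Higgs3, (2.10)–(2.11) p.426] -/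
theorem ineq31R_of_bounds (hL2 : 2 ≤ P.L) (hm : 0 < msq) (ha : 0 < a) (hk1 : 1 ≤ k) (hkK : k ≤ P.K)
    {α δ₁ δ₂ δ₃ CV CH CM : ℝ} (hα0 : 0 ≤ α) (hα1 : α ≤ 1) (hδ₁ : 0 < δ₁) (hδ₂ : 0 < δ₂) (hδ₃ : 0 < δ₃) (hCV : 0 ≤ CV)
    (hCH : 0 ≤ CH) (hCM : 0 ≤ CM)
    (hV : ∀ (j : ℕ) (x x' : HiggsLattice.Site P 0), Interior k K₀ Ω x → Interior k K₀ Ω x' →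
      (P.mesh 0 ^ P.d)⁻¹ * ∑ i' : Ix N, ‖pieceR C Ω A msq a k j (cb P N 0 (x', i')) x‖
        ≤ CV * (P.mesh j ^ 2 * (P.mesh j ^ P.d)⁻¹) * Real.exp (-(δ₁ * ((HiggsLattice.Site.tdist x x' : ℝ) / (P.L : ℝ) ^ j))))
    (hDv : ∀ (j : ℕ) (μ : Fin P.d) (x x' : HiggsLattice.Site P 0), Interior k K₀ Ω x → Interior k K₀ Ω x' →
      (P.mesh 0 ^ P.d)⁻¹ * ∑ i' : Ix N, ‖covDeriv C A (pieceR C Ω A msq a k j (cb P N 0 (x', i'))) ⟨x, μ⟩‖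
        ≤ CV * (P.mesh j * (P.mesh j ^ P.d)⁻¹) * Real.exp (-(δ₁ * ((HiggsLattice.Site.tdist x x' : ℝ) / (P.L : ℝ) ^ j))))
    (hH : ∀ (j : ℕ) (μ : Fin P.d) (x₁ x₂ x : HiggsLattice.Site P 0) (Γ : List (HiggsLattice.Site P 0)),
      Interior k K₀ Ω x₁ → Interior k K₀ Ω x₂ → Interior k K₀ Ω x → x₁ ≠ x₂ → IsAdm x₁ x₂ Γ →
      holderTermR C Ω A msq a k j μ x₁ x₂ x Γ
        ≤ (P.mesh 0 * (HiggsLattice.Site.tdist x₁ x₂ : ℝ)) ^ α *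
          (CH * (P.mesh j * (P.mesh j ^ P.d)⁻¹ * (P.mesh j ^ α)⁻¹) *
            Real.exp (-(δ₂ * (min (HiggsLattice.Site.tdist x₁ x : ℝ) (HiggsLattice.Site.tdist x₂ x : ℝ) / (P.L : ℝ) ^ j)))))
    (hM : ∀ (j : ℕ) (μ ν : Fin P.d) (x x' : HiggsLattice.Site P 0), Interior k K₀ Ω x → Interior k K₀ Ω x' →
      mixedTermR C Ω A msq a k j μ ν x x'
        ≤ CM * (P.mesh j ^ P.d)⁻¹ * Real.exp (-(δ₃ * ((HiggsLattice.Site.tdist x x' : ℝ) / (P.L : ℝ) ^ j)))) :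
    (sect3RegRegion C Ω A msq a k K₀).Ineq31 α (min δ₁ (min δ₂ δ₃) * P.L / 2)
      ((2 * CV + CH + P.d * CM) * phiSum P.L (P.d + 1) (min δ₁ (min δ₂ δ₃))) := by
  -- the common rate
  obtain ⟨δ, hδdef⟩ : ∃ δ : ℝ, δ = min δ₁ (min δ₂ δ₃) := ⟨_, rfl⟩
  rw [← hδdef]
  have hδ : 0 < δ := by rw [hδdef]; exact lt_min hδ₁ (lt_min hδ₂ hδ₃)
  have hle₁ : δ ≤ δ₁ := by rw [hδdef]; exact min_le_left _ _
  have hle₂ : δ ≤ δ₂ := by rw [hδdef]; exact (min_le_right _ _).trans (min_le_left _ _)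
  have hle₃ : δ ≤ δ₃ := by rw [hδdef]; exact (min_le_right _ _).trans (min_le_right _ _)
  have hS : ∀ μ, 2 < P.sitesPerDir 0 μ := two_lt_sitesPerDir (hk1.trans hkK) hL2
  -- the four inputs in model form with the common rate
  have hV' : ∀ (j : ℕ) (x x' : HiggsLattice.Site P 0), Interior k K₀ Ω x → Interior k K₀ Ω x' →
      (P.mesh 0 ^ P.d)⁻¹ * ∑ i' : Ix N, ‖pieceR C Ω A msq a k j (cb P N 0 (x', i')) x‖
        ≤ CV * (P.mesh j ^ 2 * (P.mesh j ^ P.d)⁻¹) * Real.exp (-(δ * ((HiggsLattice.Site.tdist x x' : ℝ) / (P.L : ℝ) ^ j))) := by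
    intro j x x' hx hx'
    have := P.mesh_pos j
    exact (hV j x x' hx hx').trans (mul_le_mul_of_nonneg_left (exp_rate_mono hle₁ (by positivity)) (by positivity))
  have hDv' : ∀ (j : ℕ) (μ : Fin P.d) (x x' : HiggsLattice.Site P 0), Interior k K₀ Ω x → Interior k K₀ Ω x' →
      (P.mesh 0 ^ P.d)⁻¹ * ∑ i' : Ix N, ‖covDeriv C A (pieceR C Ω A msq a k j (cb P N 0 (x', i'))) ⟨x, μ⟩‖
        ≤ CV * (P.mesh j * (P.mesh j ^ P.d)⁻¹) * Real.exp (-(δ * ((HiggsLattice.Site.tdist x x' : ℝ) / (P.L : ℝ) ^ j))) := by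
    intro j μ x x' hx hx'
    have := P.mesh_pos j
    exact (hDv j μ x x' hx hx').trans (mul_le_mul_of_nonneg_left (exp_rate_mono hle₁ (by positivity)) (by positivity))
  have hH' : ∀ (j : ℕ) (μ : Fin P.d) (x₁ x₂ x : HiggsLattice.Site P 0) (Γ : List (HiggsLattice.Site P 0)),
      Interior k K₀ Ω x₁ → Interior k K₀ Ω x₂ → Interior k K₀ Ω x → x₁ ≠ x₂ → IsAdm x₁ x₂ Γ →
      holderTermR C Ω A msq a k j μ x₁ x₂ x Γ
        ≤ (P.mesh 0 * (HiggsLattice.Site.tdist x₁ x₂ : ℝ)) ^ α *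
          (CH * (P.mesh j * (P.mesh j ^ P.d)⁻¹ * (P.mesh j ^ α)⁻¹) *
            Real.exp (-(δ * (min (HiggsLattice.Site.tdist x₁ x : ℝ) (HiggsLattice.Site.tdist x₂ x : ℝ) / (P.L : ℝ) ^ j)))) := by
    intro j μ x₁ x₂ x Γ hx₁ hx₂ hx hne hΓ
    have := P.mesh_pos j
    have := P.mesh_pos 0
    refine (hH j μ x₁ x₂ x Γ hx₁ hx₂ hx hne hΓ).trans (mul_le_mul_of_nonneg_left
      (mul_le_mul_of_nonneg_left (exp_rate_mono hle₂ (by positivity)) (by positivity)) (by positivity))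
  have hM' : ∀ (j : ℕ) (μ ν : Fin P.d) (x x' : HiggsLattice.Site P 0), Interior k K₀ Ω x → Interior k K₀ Ω x' →
      (P.mesh 0 ^ P.d)⁻¹ * ((P.mesh 0)⁻¹ *
          ∑ i : Ix N, ‖covDeriv C A (pieceR C Ω A msq a k j (dip C A ⟨x', ν⟩ (onb N i))) ⟨x, μ⟩‖)
        ≤ CM * (P.mesh j ^ P.d)⁻¹ * Real.exp (-(δ * ((HiggsLattice.Site.tdist x x' : ℝ) / (P.L : ℝ) ^ j))) := by
    intro j μ ν x x' hx hx'
    have := P.mesh_pos j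
    exact (hM j μ ν x x' hx hx').trans (mul_le_mul_of_nonneg_left (exp_rate_mono hle₃ (by positivity)) (by positivity))
  rw [ineq31R_iff]
  intro v v' h1
  exact normHGHR_le hS hL2 hm ha hk1 hkK hα0 hα1 hδ hCV hCH hCM hV' hDv' hH' hM' v.2 v'.2 h1

end Assembly

/-! ## §6 The located inputs (2.10) (r14), (2.11) (p35) and the mixed clause (p33) on regions, read back in the model's units;
(3.1) on regions at a regular non-constant background -/

section Inputs

variable {k K₀ : ℕ} {C : ChargeData N} {Ω : Finset (HiggsLattice.Site P 0)} {A : HiggsLattice.VecField P 0} {msq a : ℝ}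

/-- **(2.10) on a region, read back**: r14's `ineq210_regularRegion_explicit_small` conclusion (real exponents `(L^jε)^{2−d}`, `(L^jε)^{1−d}`,
rate `δ₁(L^jε)^{−1}·ε|x − x′|`) in the model's units. [cite: Balaban1983Higgs3, (2.10) p.426] -/
theorem bounds_of_ineq210R {δ₁ Cst : ℝ} {j : ℕ} {x x' : HiggsLattice.Site P 0}
    (h : (P.mesh 0 ^ P.d)⁻¹ * ∑ i' : Ix N, ‖pieceR C Ω A msq a k j (cb P N 0 (x', i')) x‖
          ≤ Cst * P.mesh j ^ ((2 : ℝ) - (P.d : ℝ)) *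
            Real.exp (-(δ₁ * (P.mesh j)⁻¹ * (P.mesh 0 * (HiggsLattice.Site.tdist x x' : ℝ)))) ∧
        ∀ μ : Fin P.d, (P.mesh 0 ^ P.d)⁻¹ * ∑ i' : Ix N, ‖covDeriv C A (pieceR C Ω A msq a k j (cb P N 0 (x', i'))) ⟨x, μ⟩‖
          ≤ Cst * P.mesh j ^ ((1 : ℝ) - (P.d : ℝ)) *
            Real.exp (-(δ₁ * (P.mesh j)⁻¹ * (P.mesh 0 * (HiggsLattice.Site.tdist x x' : ℝ))))) :
    (P.mesh 0 ^ P.d)⁻¹ * ∑ i' : Ix N, ‖pieceR C Ω A msq a k j (cb P N 0 (x', i')) x‖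
        ≤ Cst * (P.mesh j ^ 2 * (P.mesh j ^ P.d)⁻¹) * Real.exp (-(δ₁ * ((HiggsLattice.Site.tdist x x' : ℝ) / (P.L : ℝ) ^ j))) ∧
      ∀ μ : Fin P.d, (P.mesh 0 ^ P.d)⁻¹ * ∑ i' : Ix N, ‖covDeriv C A (pieceR C Ω A msq a k j (cb P N 0 (x', i'))) ⟨x, μ⟩‖
        ≤ Cst * (P.mesh j * (P.mesh j ^ P.d)⁻¹) * Real.exp (-(δ₁ * ((HiggsLattice.Site.tdist x x' : ℝ) / (P.L : ℝ) ^ j))) := by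
  obtain ⟨hv, hd⟩ := h
  rw [rpow_two_sub, mul_assoc δ₁, scale_inv_mul] at hv
  refine ⟨hv, fun μ => ?_⟩
  have h2 := hd μ
  rw [rpow_one_sub, mul_assoc δ₁, scale_inv_mul] at h2
  exact h2

/-- **(2.11) on a region, read back**: p35's `ineq211At_regularRegion_small_explicit` conclusion (`holderTermR/|x₁ − x₂|^α ≤
C(L^jε)^{1−d−α}e^{−δ₁(L^jε)^{−1}dist({x₁,x₂},x)}`) in the model's units, multiplied through by the weight `|x₁ − x₂|^α = (ε·tdist)^α`.
[cite: Balaban1983Higgs3, (2.11) p.426] -/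
theorem bound_of_ineq211AtR {α δ₁ Cst : ℝ} {j : ℕ} {μ : Fin P.d} {x₁ x₂ x : HiggsLattice.Site P 0}
    {Γ : List (HiggsLattice.Site P 0)} (hne : x₁ ≠ x₂)
    (h : holderTermR C Ω A msq a k j μ x₁ x₂ x Γ / (P.mesh 0 * (HiggsLattice.Site.tdist x₁ x₂ : ℝ)) ^ α
          ≤ Cst * P.mesh j ^ ((1 : ℝ) - (P.d : ℝ) - α) *
            Real.exp (-(δ₁ * (P.mesh j)⁻¹ * (P.mesh 0 * min (HiggsLattice.Site.tdist x₁ x : ℝ) (HiggsLattice.Site.tdist x₂ x : ℝ))))) :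
    holderTermR C Ω A msq a k j μ x₁ x₂ x Γ
      ≤ (P.mesh 0 * (HiggsLattice.Site.tdist x₁ x₂ : ℝ)) ^ α *
        (Cst * (P.mesh j * (P.mesh j ^ P.d)⁻¹ * (P.mesh j ^ α)⁻¹) *
          Real.exp (-(δ₁ * (min (HiggsLattice.Site.tdist x₁ x : ℝ) (HiggsLattice.Site.tdist x₂ x : ℝ) / (P.L : ℝ) ^ j)))) := by
  rw [rpow_one_sub_sub, mul_assoc δ₁, scale_inv_mul] at h
  have ht : 0 < P.mesh 0 * (HiggsLattice.Site.tdist x₁ x₂ : ℝ) := by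
    refine mul_pos (P.mesh_pos 0) ?_
    exact_mod_cast B3Ineq211RegularTorus.one_le_tdist_of_ne' (Ne.symm hne)
  have hpow : 0 < (P.mesh 0 * (HiggsLattice.Site.tdist x₁ x₂ : ℝ)) ^ α := Real.rpow_pos_of_pos ht _
  rw [div_le_iff₀ hpow] at h
  rw [mul_comm]
  exact h

/-- **[B3] (3.1) p. 432 ON A BIG-BLOCK-UNION REGION `Ω ⊆ T_η` AT A REGULAR NON-CONSTANT BACKGROUND `B̃ = A`, for the interior unit cubes,
PROVED.**  For `d ≥ 1`, `L ≥ 2` (no parity), `m² > 0`, `a > 0`, charge data `C`: there is a threshold `K₀min` such that for every `0 ≤ α < 1`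
and every cube size `K₀ ≥ K₀min` there are `t, δ₀, O(1) > 0` (depending on `α` and `K₀`; GAPS G-B3-11: the print's constants are uniform) with:
for every volume `P` of [B1] (1.2) with these `d, L` and `K₀ ∣ M`, every step `1 ≤ k ≤ K` with `L^kε ≤ 1` and at least three big blocks a
side (`3L^kK₀ ≤ |T_ε|_μ`), every region `Ω ⊆ T_ε` that is a union of big blocks (`IsBigBlockUnion k K₀ Ω`), and every background `A` that is
`δ_A`-regular ON `Ω` in the sense (I.2.23) with the one smallness condition `L^k·δ_A·|e| ≤ t` (the hypotheses of r14's
`ineq210_regularRegion_small`, less its redundant `1 < L`): `(sect3RegRegion C Ω A m² a k K₀).Ineq31 α δ₀ O(1)` — i.e. `‖hG_k(Ω,A)h′‖_{1,α} ≤ O(1)e^{−δ₀dist(□(v),□(v′))}`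
for all INTERIOR unit cubes `□(v), □(v′)` (cubes of `T_1^{(k)}` whose points carry the margin `2r_S + 2L^kK₀(d+1) + 1` to `T_ε ∖ Ω`) with
`dist(□(v),□(v′)) ≥ 1`.  Assembled (`ineq31R_of_bounds`) from r14's (2.10) on regions (`ineq210_regularRegion_explicit_small`), p35's (2.11) on
regions (`ineq211At_regularRegion_small_explicit`) and p33's mixed clause of (2.10) on regions (`ineq210_mixed_regularRegion`) through the
pieces (2.6), with `δ₀ = δL/2`, `δ = min` of the three input rates, `O(1) = (2C_V + C_H + dC_M)Φ_{d+1}(δ, L)`.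
[cite: Balaban1983Higgs3, (3.1) p.432] [cite: Balaban1983Higgs3, (2.10)–(2.11) p.426] [cite: Balaban1983Higgs3, (1.32) p.420]
[cite: Balaban1982Higgs1, Prop. 2.1 (2.23) p.610] -/
theorem ineq31_regularRegion (d L : ℕ) (hd : 1 ≤ d) (hL : 2 ≤ L) {a : ℝ} (ha : 0 < a) {msq : ℝ} (hmsq : 0 < msq)
    (N : ℕ) (C : ChargeData N) :
    ∃ K₀min : ℕ, ∀ {α : ℝ}, 0 ≤ α → α < 1 → ∀ K₀ : ℕ, K₀min ≤ K₀ → ∃ t δ₀ Cst : ℝ, 0 < t ∧ 0 < δ₀ ∧ 0 < Cst ∧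
      ∀ (P : HiggsLattice.Params), P.d = d → P.L = L → K₀ ∣ P.M →
      ∀ {k : ℕ}, 1 ≤ k → k ≤ P.K → (∀ μ, 3 * half P k K₀ ≤ P.sitesPerDir 0 μ) → P.mesh k ≤ 1 →
      ∀ (Ω : Finset (HiggsLattice.Site P 0)), IsBigBlockUnion k K₀ Ω →
      ∀ (A : HiggsLattice.VecField P 0) {δA : ℝ}, 0 ≤ δA →
        (∀ z ∈ Ω, ∀ μ ν : Fin P.d, |A ⟨z.shift ν, μ⟩ - A ⟨z, μ⟩| ≤ δA) →
        (P.L : ℝ) ^ k * δA * |C.e| ≤ t →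
        (sect3RegRegion C Ω A msq a k K₀).Ineq31 α δ₀ Cst := by
  have hLpos : (0 : ℝ) < L := by exact_mod_cast (by omega : 0 < L)
  obtain ⟨K₁, h210⟩ := ineq210_regularRegion_explicit_small d L hd hL ha hmsq N C
  obtain ⟨K₂, h211⟩ := ineq211At_regularRegion_small_explicit d L hd hL ha hmsq N C (a := a)
  obtain ⟨K₃, hmix⟩ := ineq210_mixed_regularRegion d L hd hL ha hmsq N C
  refine ⟨max K₁ (max K₂ K₃), fun {α} hα0 hα1 K₀ hK₀ => ?_⟩
  obtain ⟨t₁, δ₁, C₁, ht₁, hδ₁, hC₁, h210⟩ := h210 K₀ ((le_max_left _ _).trans hK₀)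
  obtain ⟨t₂, δ₂, C₂, ht₂, hδ₂, hC₂, h211⟩ := h211 hα0 hα1 K₀ (((le_max_left _ _).trans (le_max_right _ _)).trans hK₀)
  obtain ⟨t₃, δ₃, C₃, ht₃, hδ₃, hC₃, hmix⟩ := hmix K₀ (((le_max_right _ _).trans (le_max_right _ _)).trans hK₀)
  have hδ : 0 < min δ₁ (min δ₂ δ₃) := lt_min hδ₁ (lt_min hδ₂ hδ₃)
  refine ⟨min t₁ (min t₂ t₃), min δ₁ (min δ₂ δ₃) * L / 2, (2 * C₁ + C₂ + d * C₃) * phiSum L (d + 1) (min δ₁ (min δ₂ δ₃)),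
    lt_min ht₁ (lt_min ht₂ ht₃), by positivity, ?_, ?_⟩
  · have hΦ := phiSum_pos (L := L) (d + 1) hδ
    positivity
  intro P hPd hPL hK₀M k hk1 hkK h3 hmesh Ω hΩ A δA hδA hreg ht
  have hP1 : 1 < P.L := by omega
  have hL2 : 2 ≤ P.L := by omega
  have hI := h210 P hP1 hPd hPL hK₀M hk1 hkK h3 hmesh Ω hΩ A hδA hreg (ht.trans (min_le_left _ _))
  have hHo := h211 P hP1 hPd hPL hK₀M hk1 hkK h3 hmesh Ω hΩ A hδA hreg (ht.trans ((min_le_right _ _).trans (min_le_left _ _)))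
  have hMi := hmix P hPd hPL hK₀M hk1 hkK h3 hmesh Ω hΩ A hδA hreg (ht.trans ((min_le_right _ _).trans (min_le_right _ _)))
  subst hPd hPL
  -- the three located inputs in model form
  have hV : ∀ (j : ℕ) (x x' : HiggsLattice.Site P 0), Interior k K₀ Ω x → Interior k K₀ Ω x' →
      (P.mesh 0 ^ P.d)⁻¹ * ∑ i' : Ix N, ‖pieceR C Ω A msq a k j (cb P N 0 (x', i')) x‖
        ≤ C₁ * (P.mesh j ^ 2 * (P.mesh j ^ P.d)⁻¹) * Real.exp (-(δ₁ * ((HiggsLattice.Site.tdist x x' : ℝ) / (P.L : ℝ) ^ j))) :=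
    fun j x x' hx hx' => (bounds_of_ineq210R (hI j x x' hx hx')).1
  have hDv : ∀ (j : ℕ) (μ : Fin P.d) (x x' : HiggsLattice.Site P 0), Interior k K₀ Ω x → Interior k K₀ Ω x' →
      (P.mesh 0 ^ P.d)⁻¹ * ∑ i' : Ix N, ‖covDeriv C A (pieceR C Ω A msq a k j (cb P N 0 (x', i'))) ⟨x, μ⟩‖
        ≤ C₁ * (P.mesh j * (P.mesh j ^ P.d)⁻¹) * Real.exp (-(δ₁ * ((HiggsLattice.Site.tdist x x' : ℝ) / (P.L : ℝ) ^ j))) :=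
    fun j μ x x' hx hx' => (bounds_of_ineq210R (hI j x x' hx hx')).2 μ
  have hH : ∀ (j : ℕ) (μ : Fin P.d) (x₁ x₂ x : HiggsLattice.Site P 0) (Γ : List (HiggsLattice.Site P 0)),
      Interior k K₀ Ω x₁ → Interior k K₀ Ω x₂ → Interior k K₀ Ω x → x₁ ≠ x₂ → IsAdm x₁ x₂ Γ →
      holderTermR C Ω A msq a k j μ x₁ x₂ x Γ
        ≤ (P.mesh 0 * (HiggsLattice.Site.tdist x₁ x₂ : ℝ)) ^ α *
          (C₂ * (P.mesh j * (P.mesh j ^ P.d)⁻¹ * (P.mesh j ^ α)⁻¹) *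
            Real.exp (-(δ₂ * (min (HiggsLattice.Site.tdist x₁ x : ℝ) (HiggsLattice.Site.tdist x₂ x : ℝ) / (P.L : ℝ) ^ j)))) :=
    fun j μ x₁ x₂ x Γ hx₁ hx₂ hx hne hΓ => bound_of_ineq211AtR hne (hHo j μ x₁ x₂ x hx₁ hx₂ hx hne Γ hΓ)
  exact ineq31R_of_bounds hL2 hmsq ha hk1 hkK hα0 hα1.le hδ₁ hδ₂ hδ₃ hC₁.le hC₂.le hC₃.le hV hDv hH hMi

/-- **The same, un-subtyped**: under the hypotheses of `ineq31_regularRegion`, for all cube labels `v, v′ ∈ T_1^{(k)}` whose unit cubes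
consist of interior points of `Ω` and with `dist(□(v),□(v′)) ≥ 1`: `‖hG_k(Ω,A)h′‖_{1,α} = normHGHR … α v v′ ≤ O(1)e^{−δ₀dist(□(v),□(v′))}`
(the form consumers on the full lattice use). [cite: Balaban1983Higgs3, (3.1) p.432] [cite: Balaban1982Higgs1, Prop. 2.1 p.610] -/
theorem ineq31_regularRegion_explicit (d L : ℕ) (hd : 1 ≤ d) (hL : 2 ≤ L) {a : ℝ} (ha : 0 < a) {msq : ℝ} (hmsq : 0 < msq)
    (N : ℕ) (C : ChargeData N) :
    ∃ K₀min : ℕ, ∀ {α : ℝ}, 0 ≤ α → α < 1 → ∀ K₀ : ℕ, K₀min ≤ K₀ → ∃ t δ₀ Cst : ℝ, 0 < t ∧ 0 < δ₀ ∧ 0 < Cst ∧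
      ∀ (P : HiggsLattice.Params), P.d = d → P.L = L → K₀ ∣ P.M →
      ∀ {k : ℕ}, 1 ≤ k → k ≤ P.K → (∀ μ, 3 * half P k K₀ ≤ P.sitesPerDir 0 μ) → P.mesh k ≤ 1 →
      ∀ (Ω : Finset (HiggsLattice.Site P 0)), IsBigBlockUnion k K₀ Ω →
      ∀ (A : HiggsLattice.VecField P 0) {δA : ℝ}, 0 ≤ δA →
        (∀ z ∈ Ω, ∀ μ ν : Fin P.d, |A ⟨z.shift ν, μ⟩ - A ⟨z, μ⟩| ≤ δA) →
        (P.L : ℝ) ^ k * δA * |C.e| ≤ t →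
        ∀ v v' : HiggsLattice.Site P k, (∀ x, blockIter k x = v → Interior k K₀ Ω x) → (∀ x, blockIter k x = v' → Interior k K₀ Ω x) →
          1 ≤ cubeDist k v v' → normHGHR C Ω A msq a k α v v' ≤ Cst * Real.exp (-(δ₀ * cubeDist k v v')) := by
  obtain ⟨K₀min, h⟩ := ineq31_regularRegion d L hd hL ha hmsq N C
  refine ⟨K₀min, fun {α} hα0 hα1 K₀ hK₀ => ?_⟩
  obtain ⟨t, δ₀, Cst, ht, hδ₀, hCst, h⟩ := h hα0 hα1 K₀ hK₀
  refine ⟨t, δ₀, Cst, ht, hδ₀, hCst, ?_⟩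
  intro P hPd hPL hK₀M k hk1 hkK h3 hmesh Ω hΩ A δA hδA hreg ht' v v' hv hv' h1
  exact (ineq31R_iff α δ₀ Cst).1 (h P hPd hPL hK₀M hk1 hkK h3 hmesh Ω hΩ A hδA hreg ht') ⟨v, hv⟩ ⟨v', hv'⟩ h1

end Inputs

/-! ## §7 The full torus `Ω = T_ε` for every `L ≥ 2`, and the printed clause «similarly for the vector field propagator» -/

section Vector

variable {k : ℕ} {msq a : ℝ}

/-- **(3.1) on the FULL torus `Ω = T_ε` at a regular non-constant background, EVERY `L ≥ 2`** (no parity; every volume of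
`HiggsLattice.Params` with `K₀ ∣ M` and at least three cubes a side): the case `Ω = univ` of `ineq31_regularRegion` (`IsBigBlockUnion` holds
for the whole torus and every unit cube is interior, `intCube_univ`), for ALL unit cubes `□(v), □(v′)` of `T_1^{(k)}` with `dist ≥ 1` — the
no-parity companion of the torus twin's `ineq31_regularTorus` (odd-`L` `Shape` family) with the same single smallness condition.
[cite: Balaban1983Higgs3, (3.1) p.432] [cite: Balaban1982Higgs1, Prop. 2.1 (2.23) p.610] -/
theorem ineq31_regularRegion_univ (d L : ℕ) (hd : 1 ≤ d) (hL : 2 ≤ L) {a : ℝ} (ha : 0 < a) {msq : ℝ} (hmsq : 0 < msq)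
    (N : ℕ) (C : ChargeData N) :
    ∃ K₀min : ℕ, ∀ {α : ℝ}, 0 ≤ α → α < 1 → ∀ K₀ : ℕ, K₀min ≤ K₀ → ∃ t δ₀ Cst : ℝ, 0 < t ∧ 0 < δ₀ ∧ 0 < Cst ∧
      ∀ (P : HiggsLattice.Params), P.d = d → P.L = L → K₀ ∣ P.M →
      ∀ {k : ℕ}, 1 ≤ k → k ≤ P.K → (∀ μ, 3 * half P k K₀ ≤ P.sitesPerDir 0 μ) → P.mesh k ≤ 1 →
      ∀ (A : HiggsLattice.VecField P 0) {δA : ℝ}, 0 ≤ δA →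
        (∀ (z : HiggsLattice.Site P 0) (μ ν : Fin P.d), |A ⟨z.shift ν, μ⟩ - A ⟨z, μ⟩| ≤ δA) →
        (P.L : ℝ) ^ k * δA * |C.e| ≤ t →
        ∀ v v' : HiggsLattice.Site P k, 1 ≤ cubeDist k v v' →
          normHGHR C Finset.univ A msq a k α v v' ≤ Cst * Real.exp (-(δ₀ * cubeDist k v v')) := by
  obtain ⟨K₀min, h⟩ := ineq31_regularRegion_explicit d L hd hL ha hmsq N C
  refine ⟨K₀min, fun {α} hα0 hα1 K₀ hK₀ => ?_⟩
  obtain ⟨t, δ₀, Cst, ht, hδ₀, hCst, h⟩ := h hα0 hα1 K₀ hK₀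
  refine ⟨t, δ₀, Cst, ht, hδ₀, hCst, ?_⟩
  intro P hPd hPL hK₀M k hk1 hkK h3 hmesh A δA hδA hreg ht' v v' h1
  exact h P hPd hPL hK₀M hk1 hkK h3 hmesh Finset.univ isBigBlockUnion_univ A hδA (fun z _ μ ν => hreg z μ ν) ht' v v'
    (intCube_univ k K₀ v) (intCube_univ k K₀ v') h1

/-- **On the full torus the region quantity IS the torus twin's**: `‖hG_k(T_ε,A)h′‖_{1,α}` of this file at `Ω = univ` and
`B3Ineq31RegularTorus.normHGH` agree (r14's region propagator at `Ω = T_ε` is the torus propagator, by definition).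
[cite: Balaban1983Higgs3, (3.1) p.432] -/
theorem normHGHR_univ (C : ChargeData N) (A : HiggsLattice.VecField P 0) (msq a : ℝ) (k : ℕ) (α : ℝ) (v v' : HiggsLattice.Site P k) :
    normHGHR C Finset.univ A msq a k α v v' = B3Ineq31RegularTorus.normHGH C A msq a k α v v' := rfl

/-- **For `Ω = T_ε` the region carrier's (3.1) IS the torus twin's (3.1)** (same cubes — all of `T_1^{(k)}` —, same distance, same norm):
`(sect3RegRegion C T_ε A …).Ineq31 α δ₀ C ↔ (B3Ineq31RegularTorus.sect3RegTorus S C A …).Ineq31 α δ₀ C` for any `S : Shape P` (the torus twin's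
carrier is indexed by the odd-`L` shape datum, which its data do not use). [cite: Balaban1983Higgs3, (3.1) p.432] -/
theorem ineq31R_univ_iff_torus (S : B1Eq211ZeroFieldTorus.Shape P) (C : ChargeData N) (A : HiggsLattice.VecField P 0) (msq a : ℝ)
    (k K₀ : ℕ) (α δ₀ Cst : ℝ) :
    (sect3RegRegion C Finset.univ A msq a k K₀).Ineq31 α δ₀ Cst ↔
      (B3Ineq31RegularTorus.sect3RegTorus S C A msq a k).Ineq31 α δ₀ Cst := by
  rw [ineq31R_iff, B3Ineq31RegularTorus.ineq31_iff]
  constructor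
  · intro h v v' h1
    exact h ⟨v, intCube_univ k K₀ v⟩ ⟨v', intCube_univ k K₀ v'⟩ h1
  · intro h v v' h1
    exact h v.1 v'.1 h1

/-- **The torus twin for EVERY `L ≥ 2`**: under the hypotheses of `ineq31_regularRegion_univ`, the torus twin's quantity
`B3Ineq31RegularTorus.normHGH C A m² a k α v v′ = ‖hG_k(T_η,A)h′‖_{1,α}` obeys (3.1) for all unit cubes at distance `≥ 1` — the odd-`L`
restriction of `B3Ineq31RegularTorus.ineq31_regularTorus` (the `Shape` family of its torus inputs) is lifted by the region inputs.
[cite: Balaban1983Higgs3, (3.1) p.432] [cite: Balaban1982Higgs1, Prop. 2.1 (2.23) p.610] -/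
theorem ineq31_regularTorus_allL (d L : ℕ) (hd : 1 ≤ d) (hL : 2 ≤ L) {a : ℝ} (ha : 0 < a) {msq : ℝ} (hmsq : 0 < msq)
    (N : ℕ) (C : ChargeData N) :
    ∃ K₀min : ℕ, ∀ {α : ℝ}, 0 ≤ α → α < 1 → ∀ K₀ : ℕ, K₀min ≤ K₀ → ∃ t δ₀ Cst : ℝ, 0 < t ∧ 0 < δ₀ ∧ 0 < Cst ∧
      ∀ (P : HiggsLattice.Params), P.d = d → P.L = L → K₀ ∣ P.M →
      ∀ {k : ℕ}, 1 ≤ k → k ≤ P.K → (∀ μ, 3 * half P k K₀ ≤ P.sitesPerDir 0 μ) → P.mesh k ≤ 1 →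
      ∀ (A : HiggsLattice.VecField P 0) {δA : ℝ}, 0 ≤ δA →
        (∀ (z : HiggsLattice.Site P 0) (μ ν : Fin P.d), |A ⟨z.shift ν, μ⟩ - A ⟨z, μ⟩| ≤ δA) →
        (P.L : ℝ) ^ k * δA * |C.e| ≤ t →
        ∀ v v' : HiggsLattice.Site P k, 1 ≤ cubeDist k v v' →
          B3Ineq31RegularTorus.normHGH C A msq a k α v v' ≤ Cst * Real.exp (-(δ₀ * cubeDist k v v')) :=
  ineq31_regularRegion_univ d L hd hL ha hmsq N C

/-- **«For external vector fields we have the same definition, but with B̃ = 0» (p. 420)**: for the trivial coupling `zeroCharge` every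
transport `U(A(Γ))` is the identity (`zeroCharge_U`), so the transports of (1.32) disappear: `τ_{c,c′}M = M`.
[cite: Balaban1983Higgs3, (1.32) p.420] [cite: Balaban1982Higgs1, p.608] -/
theorem transp_zeroCharge (A : HiggsLattice.VecField P 0) (c c' : PBd P) (M : E P.d →L[ℝ] E P.d) :
    transp (zeroCharge P.d) A c c' M = M := by
  have h1 : ∀ (x : HiggsLattice.Site P 0) (Γ : List (HiggsLattice.Site P 0)), hol (zeroCharge P.d) A x Γ = 1 :=
    fun x Γ => zeroCharge_U P.d _ _
  unfold transp
  rw [h1, h1, star_one, ContinuousLinearMap.one_def, ContinuousLinearMap.comp_id, ContinuousLinearMap.id_comp]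

/-- **The two-variable field of the vector-propagator instance IS the kernel of the vector-field propagator `G_k` of p. 414** (*"the field
A′ has the covariance G_k"*; `N = d`, `A = 0`, `Ω = T_ε`), whose scale pieces (2.6) are p33's `B3Ineq212VectorTorus.vecPieceOp`
(`= pieceR (zeroCharge d) T_ε 0`, by definition): `F(x,x′)v = (L^kε)^{d−2}ε^{−d}·Σ_{j<k}(G^η_{(j)}δ_{x′}v)(x)`.
[cite: Balaban1983Higgs3, (2.6) p.424, (3.1) p.432] -/
theorem kerFR_vector_apply (hmsq : 0 < msq) (ha : 0 < a) (hL1 : 1 < P.L) (hk1 : 1 ≤ k) (hkK : k ≤ P.K) (z : PSite P) (v : E P.d) :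
    kerFR (zeroCharge P.d) Finset.univ (0 : HiggsLattice.VecField P 0) msq a k z v
      = unitV P k • ∑ j ∈ Finset.range k, vecPieceOp P msq a k j (Pi.single z.2 v) z.1 := by
  rw [kerFR, _root_.smul_apply, blockKR_apply,
    ← sum_pieceR (C := zeroCharge P.d) (Ω := Finset.univ) (A := 0) hmsq ha hL1 hk1 hkK, LinearMap.sum_apply, Finset.sum_apply]
  rfl

/-- **[B3] (3.1) p. 432, the clause «and similarly for the vector field propagator», PROVED on print's torus for EVERY `L ≥ 2`.**  The
vector-field propagator `G_k` of p. 414 is the `N = d` propagator on the whole torus at zero background ([B1] p. 608 *"taking N = d and an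
external vector field A = 0"*) with a positive mass ([B1] p. 605, `μ₀² > 0`); its pieces (2.6) are p33's `vecPieceOp` (`kerFR_vector_apply`)
and the norm (1.32) is taken *"with B̃ = 0"* (`transp_zeroCharge`).  For `d ≥ 1`, `L ≥ 2`, `m² > 0`, `a > 0`: a threshold `K₀min` and, for every
`0 ≤ α < 1` and `K₀ ≥ K₀min`, constants `δ₀, O(1) > 0` with: for every volume `P` with these `d, L` and `K₀ ∣ M`, every `1 ≤ k ≤ K` with
`L^kε ≤ 1` and `3L^kK₀ ≤ |T_ε|_μ`, and ALL unit cubes `□(v), □(v′)` of `T_1^{(k)}` with `dist(□(v),□(v′)) ≥ 1`: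
`‖hG_kh′‖_{1,α} ≤ O(1)e^{−δ₀dist(□(v),□(v′))}` — the instance `C = zeroCharge d`, `Ω = T_ε`, `A = 0` (`δ_A = 0`) of `ineq31_regularRegion`.
[cite: Balaban1983Higgs3, (3.1) p.432] [cite: Balaban1983Higgs3, p.414] [cite: Balaban1982Higgs1, p.608] -/
theorem ineq31_vectorTorus (d L : ℕ) (hd : 1 ≤ d) (hL : 2 ≤ L) {a : ℝ} (ha : 0 < a) {msq : ℝ} (hmsq : 0 < msq) :
    ∃ K₀min : ℕ, ∀ {α : ℝ}, 0 ≤ α → α < 1 → ∀ K₀ : ℕ, K₀min ≤ K₀ → ∃ δ₀ Cst : ℝ, 0 < δ₀ ∧ 0 < Cst ∧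
      ∀ (P : HiggsLattice.Params), P.d = d → P.L = L → K₀ ∣ P.M →
      ∀ {k : ℕ}, 1 ≤ k → k ≤ P.K → (∀ μ, 3 * half P k K₀ ≤ P.sitesPerDir 0 μ) → P.mesh k ≤ 1 →
        (sect3RegRegion (zeroCharge P.d) Finset.univ (0 : HiggsLattice.VecField P 0) msq a k K₀).Ineq31 α δ₀ Cst ∧
        ∀ v v' : HiggsLattice.Site P k, 1 ≤ cubeDist k v v' →
          normHGHR (zeroCharge P.d) Finset.univ (0 : HiggsLattice.VecField P 0) msq a k α v v'
            ≤ Cst * Real.exp (-(δ₀ * cubeDist k v v')) := by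
  obtain ⟨K₀min, h⟩ := ineq31_regularRegion d L hd hL ha hmsq d (zeroCharge d)
  refine ⟨K₀min, fun {α} hα0 hα1 K₀ hK₀ => ?_⟩
  obtain ⟨t, δ₀, Cst, ht, hδ₀, hCst, h⟩ := h hα0 hα1 K₀ hK₀
  refine ⟨δ₀, Cst, hδ₀, hCst, ?_⟩
  intro P hPd hPL hK₀M k hk1 hkK h3 hmesh
  subst hPd
  have hreg : ∀ z ∈ (Finset.univ : Finset (HiggsLattice.Site P 0)), ∀ μ ν : Fin P.d,
      |(0 : HiggsLattice.VecField P 0) ⟨z.shift ν, μ⟩ - (0 : HiggsLattice.VecField P 0) ⟨z, μ⟩| ≤ 0 := by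
    intro z _ μ ν; simp
  have ht' : (P.L : ℝ) ^ k * (0 : ℝ) * |(zeroCharge P.d).e| ≤ t := by rw [mul_zero, zero_mul]; exact ht.le
  have hI := h P rfl hPL hK₀M hk1 hkK h3 hmesh Finset.univ isBigBlockUnion_univ 0 le_rfl hreg ht'
  exact ⟨hI, fun v v' h1 => (ineq31R_iff α δ₀ Cst).1 hI ⟨v, intCube_univ k K₀ v⟩ ⟨v', intCube_univ k K₀ v'⟩ h1⟩

end Vector

end Literature.MathematicalPhysics.QuantumFieldTheory.Balaban1983to89.B3Ineq31RegularRegion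

end
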